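import Mathlib
import Literature.Computability.AlgebraicComplexity.BirkhoffShadowProofs
import Literature.Computability.AlgebraicComplexity.NestFreeMatchingPoly
import Literature.Computability.AlgebraicComplexity.CircuitDepth
import Literature.Computability.MetaComplexity.GridTseitinLift
import Literature.Computability.AlgebraicComplexity.HomogeneousComponentsComplexity
import Literature.Computability.AlgebraicComplexity.ChowSymmetric
import Literature.Combinatorics.Optimization.GridCorCliqueFace
import Summits.ValiantsHypothesis.ValiantsHypothesis.Theorems.DivisionGapShadowCofactorSplit
import Summits.ValiantsHypothesis.ValiantsHypothesis.Theorems.FifoMatchingNFPolytopeQueueGridPPHardOfCorGridMinor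
import Summits.ValiantsHypothesis.ValiantsHypothesis.Theorems.FifoMatchingNFPolytopeQueueGridFaceProjection
import Summits.ValiantsHypothesis.ValiantsHypothesis.Theses.FifoMatching
import HarnessLib

/-!
# NEXT-RUNG-2 (LENS dual, val-idea-7 g7): the SHADOW rung — `NN·h` is hard for EVERY cofactor of QUASI-POLYNOMIAL
# degree `≤ 2^{(log₂ n + k)^k}`, from the K1 gadget (A1) + the AFHMS clique face (G♭), by Hrubeš–Yehudayoff shadows

Crux chain `Cruxes/NNLinearDegreeCofactorHard/` (stmt-23918 CLOSED·proved = linear-degree cofactors; residual of the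
route = `NNDivisionHard` stmt-21181, all cofactors).  This file TYPES the next rung and its inputs and kernel-checks
everything between the two named inputs and the rung: (rev 2) the port S `rung_of_shadow : NFPShadowHard → R2` (HY21
Thm 42 + balancing, NN instance); (rev 3) T1 `ppShadow_of_grid` over c1's `corMap`; (rev 4) T2 `faceLift` (HY21
Lemma 10 in point form, `um_lift`, + Prop 23 pencils); (rev 5, crit-3 VERDICT #21 prices P1/P3/P4) G is RE-PLANNED as
«G♭ ⇒ G»: `gridCorShadowHard_of_cliqueFace : GridCorCliqueFace → GridCorShadowHard` PROVED (HY21 Prop 19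
`clique_parabola_shadow` + the valid-inequality face lift `um_lift_face`), and the K1 vocabulary is imported from c1's
canonical Theorems files (no copies); (rev 5b) G♭ is the route item stmt-27045 `Theses.FifoMatching.GridCorCliqueFace`
BY NAME and the division-side twins are audited `Iff.rfl` against the route decls; (rev 6) a G♭ CONSTRUCTOR TOOLKIT for the
27045 lead — `faceProj_compose` (face–projection steps compose: the flattening FORM A needs, since AFHMS's face yields
`COR(K_{h,h})`, not `COR(K_h)`) and `corBiclique_faceProj_corClique` (`K_h ≼ K_{h,h}` as ONE explicit face + read-out,
PROVED); (rev 7) the ORDER UPGRADE, PROVED: `orderRung_of_rung : R2 → R2ᵒ` (every cofactor with SOME nonzero homogeneous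
component of quasi-polynomial degree — e.g. a nonzero constant term —, by BCS Lemma 21.25 in the tree +
`NN_n` homogeneous), `orderReduction_of_reduction : N2 → N2♯` and `route_21181_of_flat_order : A1 → 27045 → N2♯ → 21181`,
so the honest residual of 21181 after this line shrinks from N2 to N2♯ (cofactors supported ENTIRELY in
super-quasi-polynomial degrees); (rev 8) **A1 DISCHARGED**: `queueGridZeroOnePoints_holds` proves the point form of the
located coordinate face from val-width-26254-qg1 g0's landed gadget facts (`design_mem_nestFreeMatchings`,
`design_mem_allowed`, `exists_design_eq`, `coordMap_arc_iff` — the instantiation of the landed `queueGridFaceProjection`,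
p617795) through the point-form sibling `zeroOnePoints_of_gadget_prop` of c1's `face_projection_of_gadget_prop`; hence
`rung_of_27045 : Theses.FifoMatching.GridCorCliqueFace → R2`, `orderRung_of_27045`, `nfpShadowHard_of_27045` and
`route_21181_of_27045_order : 27045 → N2♯ → 21181` hold from the route item 27045 ALONE; (rev 9) **SORRY-FREE**:
item 27045 is CLOSED·proved (2026-08-28T09:44Z, p622413, on the Literature chain G1–G6 of p10 g2 / p9 g1 / p4 g12, last
file p621663 `Literature/Combinatorics/Optimization/GridCorCliqueFace.lean`), so `stub_cliqueFace :=
Literature.Combinatorics.Optimization.AboulkerEtAl2019_gridCorCliqueFace` and EVERY conclusion of the line holds outright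
from theorems in the tree: `rung_holds : R2`, `rung_27271 : Theses.FifoMatching.NNQuasiPolyLogDegreeCofactorHard` (the R2
route item stmt-27271 BY NAME; its ledger closing is the Theorems port F5/F8 of val-port-2 g1 / val-port-4 g1, R198 (c)),
`orderRung_holds : R2ᵒ`, `nfpShadowHard_holds : N1`, and `route_21181_of_orderReduction : N2♯ →
Theses.FifoMatching.NNDivisionHard` — the crux stmt-21181 now rests on the law-side residual N2♯ ALONE; (rev 10) the
**EXPONENTIAL RUNG** `expRung_holds : NNExpDegreeCofactorHard` — eventually in `n`, `2^{n^{1/8}} < L₊(NN_n·h)` for EVERY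
nonzero cofactor of degree `≤ 2^{n^{1/8}}` (`n^{1/8} := root8 n`, three nested `Nat.sqrt`) —, PROVED sorry-free by
re-running the chain with the bound left free (`gridCor_count`, `pp_count`, `nfp_count`: geometric rate
`σ(NFP_n) > B` whenever `16·B < 2^h`, `h ≥ c₀·⌊(⌊√n⌋/2−1)/2⌋`, i.e. `2^{Ω(√n)}` shadow vertices) and balancing at
`E = n^{1/8} + 2 log₂ n + 5` (`exp_threshold`, `expRung_of_count`); `expBound_holds` is its `h = 1` instance.  Nothing
here proves VP ≠ VNP; K1 (stmt-26254) is CLOSED unconditionally since 09:44Z (p622422); currency = monotone (semiring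
`ℝ≥0`) complexity.

GRADE / PLACEMENT (crit-3 #21, PASS-WITH-PRICE, tier STRUCTURE, new-combination): the line is HY21 Prop 43(2) / Rem 20
[HrubesYehudayoff2021 p.17: "σ is a lower bound on monotone formula size for f AND ALL ITS MULTIPLES … via a located
0/1 polytope"] with Clique ↦ `NN_n` through the located face of K1; both inputs are now THEOREMS in the tree: (A1 = the K1
gadget combinatorics, qg1 h1–h4 — PROVED and, since rev 8, glued here), G♭ = AFHMS 2019 (item 27045, CLOSED rev 9) [arXiv:1806.00541 pp. 5–6: gadget grid `H` as a minor of
`G_{t,t}` with `h = Ω(t)`, Lichtenstein crossovers, one face of `COR(H)` projecting onto `COR(K_{h,h})`, then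
`K_h ≼ K_{h,h}` — flattened by the rev-6 toolkit into FORM A's one face of `COR(G_{t,t})` onto `COR(K_h)`].  Rates (via
AFHMS, NOT via the withdrawn squaring-circuit sketch of rev 1): `σ(COR(G_{t,t})) ≥ 2^{Ω(t)}`, `σ(NFP_n) ≥ 2^{Ω(√n)}`;
below everything is stated in the route's quasi-polynomial threshold currency `T c n = 2^((log₂ n + c)^c)`.

THE LEVER (dual / parametric-LP view).  The SHADOW COMPLEXITY `σ_L(P) = #vert L(P)` of a 2-dimensional linear image
(= number of breakpoints of the parametric LP `max ⟨w₀ + t w₁, x⟩`, HY21 Thm 4) is (i) at most the number of leaves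
of any MONOTONE FORMULA computing ANY nonzero monotone multiple `f·h` (HY21 Thm 1 + Lemma 12 = Thm 42: over `ℝ≥0`,
`Newt(f h) = Newt f + Newt h` and planar Minkowski sums only add vertices) — this is DIVISION-ROBUST, unlike every
engine used so far on this crux — and (ii) monotone circuits of size `s` and degree `d` balance to monotone formulas
of size `2^{O(log(sd)·log d)}` (Hyafil/VSBR/Brent over any commutative semiring — PROVED in the tree:
`Literature.Computability.AlgebraicComplexity.formulaComplexity_le_two_pow`).  Hence
  `σ(NFP_n) super-quasi-polynomial  ⟹  L₊(NN_n·h) super-quasi-polynomial for every h ≠ 0 with deg h ≤ 2^{quasipolylog n}`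
(`NNQuasiPolyLogDegreeCofactorHard`, the RUNG; it contains the closed rungs 22993/23918 and leaves as residual of 21181
exactly the NN-twin `NNCofactorDegreeReduction` of the permanent route's `PerCofactorDegreeReduction`; HY21 Thm 30 —
circuits escape shadows — is why the degree cap is essential).
The permanent twin of the shadow hypothesis, `DivisionGap.ShadowBirkhoff` = HY21 OPEN PROBLEM 1 (σ of the Birkhoff
polytope), is why that route is dormant.  THE POINT OF THIS LINE: for NN the shadow hypothesis is NOT a free-standing
open problem — it REDUCES to located faces.  By A1 (`QueueGridZeroOnePoints`) a COORDINATE FACE of `NFP_n` reads out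
exactly onto the pair-pattern polytope `PP_r` (`r ≈ √n/2`), which maps linearly ONTO `COR(G_{g,g})`, `g = ⌊r/2⌋`
(c1's `corMap_image_queueGridPP` / `range_corMap_patternVec`, PROVED); by G♭ a FACE of `COR(G_{t,t})` maps linearly onto
`COR(K_h)`, `h = Ω(t)`; and `σ(COR(K_h)) = 2^h` by the parabola map `x ↦ (Σ 2^i x_ii, Σ 2^{i+j} x_ij)` (HY21 Prop 19,
PROVED here).  Shadows pull back along linear maps verbatim and lift from faces cut out by valid inequalities at the
loss of a factor 4 (uniquely-maximised points of a pencil transfer loss-free, `um_lift_face`; ≥ ¼ of the vertices are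
such points for one of four pencils, HY21 Prop 23 `extremePoints_subset_um4`) — all PROVED here.

Sources: P. Hrubeš, A. Yehudayoff, Shadows of Newton polytopes, CCC 2021 (LIPIcs 200:9) = Israel J. Math. 256 (2023)
[HrubesYehudayoff2021; corpus paper:url-d136d073b26d: Thm 1 p.2, Thm 4 p.3, Lemma 10/11/12 p.7, Prop 19/Rem 20 p.10,
Prop 22/23 p.10–11, Thm 30 p.13, Prop 43(2)/Rem 20 p.17]; M. Aboulker, S. Fiorini, T. Huynh, M. Macchia, J. Seif,
Extension complexity of the correlation polytope, Oper. Res. Lett. 47 (2019) [AboulkerEtAl2019, arXiv:1806.00541 pp. 5–6;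
tree fact `Literature.Combinatorics.Optimization.AboulkerEtAl2019_corGridMinor`]; tree: `Theses/DivisionGap.lean` items
ShadowBirkhoff / PerCofactorDegreeReduction / PerMultiplesHard / ShadowCofactorSplit (PROVED,
`Theorems/DivisionGapShadowCofactorSplit{,Formula}.lean`), `formulaComplexity_le_two_pow`,
`HrubesYehudayoff2021Prop23.extremePoints_subset_um4`; c1's canonical K1 files
`Theorems/FifoMatchingNFPolytopeQueueGridFaceDefs|QueueGridCorProjection|QueueGridPPHardOfCorGridMinor.lean`;
K1 line `Lines/queue_grid_face.{lean,md}` (A1).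
-/

set_option linter.unusedVariables false
set_option linter.dupNamespace false

open MvPolynomial Literature.Computability.AlgebraicComplexity
open Literature.Computability.MetaComplexity (gridGraph gridAdj)
open scoped NNReal Pointwise
open Matrix
open Summit.ValiantsHypothesis.DivisionGap.ShadowDegreeSplit
open Summit.ValiantsHypothesis.ValiantsHypothesis.Theorems.DivisionGap.ShadowCofactorSplit

namespace Summit.ValiantsHypothesis.ValiantsHypothesis.Cruxes.NNLinearDegreeCofactorHard.ShadowDivision

-- P3 (crit-3 #21): the K1 vocabulary is consumed BY NAME from c1's canonical Theorems files (p613693 Defs,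
-- p615220 CorProjection, PPHardOfCorGridMinor bridge), no copies.
open Summit.ValiantsHypothesis.ValiantsHypothesis.Theorems.FifoMatching.QueueGridFace
  (realOf suppPts newt QGV qgEdge patternVec queueGridPP corVertex corMap corMap_patternVec range_corMap_patternVec
   corMap_image_queueGridPP corVec_eq_corVertex growth_eventually)
open Literature.Combinatorics.Optimization (corVec corPolytopeGraph)
-- G♭ = the FifoMatching support item stmt-ValiantsHypothesis-27045 (Theses/FifoMatching.lean rev 10), BY NAME
open Summit.ValiantsHypothesis.ValiantsHypothesis.Theses.FifoMatching (GridCorCliqueFace)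

noncomputable section

/-! ## A1 — the located coordinate face of `NFP_n` (shared with the K1 line; vocabulary = c1's canonical Defs) -/

/-- **A1 — the 0/1 points of the queue-grid face** (val-idea-7 g6/g7; the COMBINATORIAL HEART of input A, proved on
paper for all `r` in memo §9 — layout-B rigidity by a FIFO window induction — and verified by exact memoised count
for all `r ≤ 7`, `sim/queue_grid_rigidity_memo.py`): for `r ≥ 1`, `n ≥ (r+1)(2r+1)` there are a finite set `Z` of
coordinates (the arcs outside `E* ∪ pad`) and a read-out map `f` (bit-pair `(uv,a,b)` ↦ the indicator arc
`e^{ab}_{uv}`, non-edges ↦ a never-used diagonal coordinate) such that the exponent vectors of `NN_n` vanishing on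
`Z` — i.e. the nest-free perfect matchings supported on `E* ∪ pad` — read through `f` are EXACTLY the pattern vectors
`patternVec r X`, `X : QGV r → Bool`.  No polytope, no extended formulation in the statement. -/
def QueueGridZeroOnePoints : Prop :=
  ∀ r n : ℕ, 1 ≤ r → (r + 1) * (2 * r + 1) ≤ n →
    ∃ (Z : Finset (Fin (2 * n) × Fin (2 * n)))
      (f : (QGV r × QGV r) × Bool × Bool → Fin (2 * n) × Fin (2 * n)),
      (fun x : (Fin (2 * n) × Fin (2 * n)) → ℝ => x ∘ f) ''
          (suppPts (nestFreeMatchingPoly n ℝ≥0) ∩ {x | ∀ e ∈ Z, x e = 0}) = Set.range (patternVec r)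

/-! ## Shadow statements (HY21 currency: number of vertices of a 2-dimensional linear image) -/

/-- the quasi-polynomial threshold of the route -/
abbrev T (c n : ℕ) : ℕ := 2 ^ ((Nat.log 2 n + c) ^ c)

/-- number of vertices of the shadow polygon `conv(L S)` -/
def shadowVerts {ι : Type} (S : Set (ι → ℝ)) (L : (ι → ℝ) →ₗ[ℝ] (Fin 2 → ℝ)) : ℕ :=
  Set.ncard (Set.extremePoints ℝ (convexHull ℝ (L '' S)))

/-- **N1 — NFP shadow hardness** (NN twin of `DivisionGap.ShadowBirkhoff`; HERE reducible to A1 + `GridCorShadowHard`,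
`nfpShadowHard_of`): for every `c`, eventually in `n`, some planar shadow of `NFP_n = Newt(NN_n)` has more than
`2^((log₂ n + c)^c)` vertices (equivalently: parametric max-weight FIFO perfect matching has that many breakpoints).
True rate via A1 + G♭ (AFHMS): `2^{Ω(√n)}`. -/
def NFPShadowHard : Prop :=
  ∀ c : ℕ, ∃ n₀ : ℕ, ∀ n ≥ n₀, ∃ L : ((Fin (2 * n) × Fin (2 * n)) → ℝ) →ₗ[ℝ] (Fin 2 → ℝ),
    T c n < shadowVerts (suppPts (nestFreeMatchingPoly n ℝ≥0)) L

/-- **G — grid correlation shadow hardness** (σ-currency form of the AFHMS core; crit-3 #21: IN PRINT — AFHMS 2019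
[arXiv:1806.00541 pp. 5–6: grid-with-gadgets `H ≼ G_{t,t}` of height `h = Ω(t)`, Lichtenstein crossovers, ONE face of
`COR(G_{t,t})` projecting onto `COR(K_h)`] + HY21 Prop 19 [σ(COR(K_h)) = 2^h, `clique_parabola_shadow` below] + ONE face
lift (`um_lift_face` below) ⇒ rate `2^{Ω(t)}`; DERIVED here from the construction statement G♭ `GridCorCliqueFace`
by `gridCorShadowHard_of_cliqueFace`): for every `c`, eventually in `t`, some planar shadow of the vertex set of
`COR(G_{t,t})` has more than `2^((log₂ t + c)^c)` vertices. -/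
def GridCorShadowHard : Prop :=
  ∀ c : ℕ, ∃ t₀ : ℕ, ∀ t ≥ t₀, ∃ L : ((Fin (t * t) × Fin (t * t)) → ℝ) →ₗ[ℝ] (Fin 2 → ℝ),
    T c t < shadowVerts (Set.range (corVec (gridGraph t))) L

/- **G♭ — the AFHMS clique face** is the route item `Summit.ValiantsHypothesis.ValiantsHypothesis.Theses.FifoMatching.
GridCorCliqueFace` (stmt-ValiantsHypothesis-27045, support r9, filed by tenure g12 2026-08-28T08:53Z = crit-3 FORM A verbatim):
for some `c > 0`, eventually in `t`, there are `h ≥ c·t`, finitely many inequalities valid on `COR(G_{t,t})` and a linear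
`π` with `π (COR(G_{t,t}) ∩ {all tight}) = COR(K_h)` [AFHMS 2019, arXiv:1806.00541 pp. 5–6].  Consumed BY NAME below. -/

/-- **PP shadow hardness** (intermediate): shadows of the pair-pattern polytope `PP_r = conv(range patternVec r)`. -/
def PPShadowHard : Prop :=
  ∀ c : ℕ, ∃ r₀ : ℕ, ∀ r ≥ r₀, ∃ Λ : (((QGV r × QGV r) × Bool × Bool) → ℝ) →ₗ[ℝ] (Fin 2 → ℝ),
    T c r < shadowVerts (Set.range (patternVec r)) Λ

/-! ## Division-side statements (NN twins of the `DivisionGap` items; `nestFreeMatchingPoly n ℝ≥0` is definitionally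
the route's inlined `NN_n`) -/

/-- **R2 — THE RUNG**: `NN_n·h` is quasi-polynomially hard for every nonzero cofactor of QUASI-POLYNOMIAL degree
`deg h ≤ 2^((log₂ n + k)^k)`, every `k` (no `+ L₊(h)` needed).  Contains 22993 (deg ≤ d) and 23918 (linear degree,
`linearDegree_of_rung`); = HY21 Prop 43(2)/Rem 20 for `NN_n` with the located face supplied by A1 + G♭. -/
def NNQuasiPolyLogDegreeCofactorHard : Prop :=
  ∀ k c : ℕ, ∃ n₀ : ℕ, ∀ n ≥ n₀, ∀ h : MvPolynomial (Fin (2 * n) × Fin (2 * n)) ℝ≥0, h ≠ 0 →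
    h.totalDegree ≤ 2 ^ ((Nat.log 2 n + k) ^ k) → T c n < complexity (nestFreeMatchingPoly n ℝ≥0 * h)

/-- **N3 — NN multiples hardness** (twin of `DivisionGap.PerMultiplesHard`; implies `NNDivisionHard`). -/
def NNMultiplesHard : Prop :=
  ∀ c : ℕ, ∃ n₀ : ℕ, ∀ n ≥ n₀, ∀ h : MvPolynomial (Fin (2 * n) × Fin (2 * n)) ℝ≥0, h ≠ 0 →
    T c n < complexity (nestFreeMatchingPoly n ℝ≥0 * h)

/-- **N2 — NN cofactor degree reduction** (twin of `DivisionGap.PerCofactorDegreeReduction`): a cheap multiple can be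
traded for a cheap multiple of quasi-polynomial DEGREE.  This is the genuine RESIDUAL of `NNDivisionHard` after R2. -/
def NNCofactorDegreeReduction : Prop :=
  ∃ k : ℕ, ∀ (n : ℕ) (h : MvPolynomial (Fin (2 * n) × Fin (2 * n)) ℝ≥0), h ≠ 0 →
    ∃ h' : MvPolynomial (Fin (2 * n) × Fin (2 * n)) ℝ≥0, h' ≠ 0 ∧
      h'.totalDegree ≤ 2 ^ ((Nat.log 2 n + Nat.log 2 (complexity (nestFreeMatchingPoly n ℝ≥0 * h)) + k) ^ k) ∧
      complexity (nestFreeMatchingPoly n ℝ≥0 * h') ≤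
        2 ^ ((Nat.log 2 n + Nat.log 2 (complexity (nestFreeMatchingPoly n ℝ≥0 * h)) + k) ^ k)

/-- **R2ᵒ — the ORDER form of the rung** (rev 7; PROVED from R2 by `orderRung_of_rung`): `NN_n · h` is hard for
every cofactor `h` having SOME nonzero homogeneous component of quasi-polynomial degree — e.g. every `h` with a nonzero
constant term (`constantTerm_cofactor_hard`) — whatever its total degree.  Ingredients: `NN_n` is homogeneous of degree
`n` (`nestFreeMatchingPoly_isHomogeneous`), so `(NN_n·h)^{(n+d)} = NN_n · h^{(d)}` (`weightedHomogeneousComponent_mul_left`,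
[Chow]), and homogeneous components cost `(deg+2)²` [BCS Lemma 21.25 = `complexity_homogeneousComponent_le_sq_mul`, any
commutative semiring, so `ℝ≥0`]. -/
def NNQuasiPolyLogOrderCofactorHard : Prop :=
  ∀ k c : ℕ, ∃ n₀ : ℕ, ∀ n ≥ n₀, ∀ h : MvPolynomial (Fin (2 * n) × Fin (2 * n)) ℝ≥0, ∀ d : ℕ,
    homogeneousComponent d h ≠ 0 → d ≤ 2 ^ ((Nat.log 2 n + k) ^ k) →
      T c n < complexity (nestFreeMatchingPoly n ℝ≥0 * h)

/-- **N2♯ — NN cofactor ORDER reduction** (rev 7): the residual of `NNDivisionHard` after R2ᵒ — WEAKER than N2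
(`orderReduction_of_reduction`): a cheap multiple can be traded for a cheap multiple having SOME nonzero homogeneous
component of quasi-polynomial degree.  What it leaves genuinely open = cofactors supported ENTIRELY in
super-quasi-polynomial degrees. -/
def NNCofactorOrderReduction : Prop :=
  ∃ k : ℕ, ∀ (n : ℕ) (h : MvPolynomial (Fin (2 * n) × Fin (2 * n)) ℝ≥0), h ≠ 0 →
    ∃ (h' : MvPolynomial (Fin (2 * n) × Fin (2 * n)) ℝ≥0) (d : ℕ), homogeneousComponent d h' ≠ 0 ∧
      d ≤ 2 ^ ((Nat.log 2 n + Nat.log 2 (complexity (nestFreeMatchingPoly n ℝ≥0 * h)) + k) ^ k) ∧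
      complexity (nestFreeMatchingPoly n ℝ≥0 * h') ≤
        2 ^ ((Nat.log 2 n + Nat.log 2 (complexity (nestFreeMatchingPoly n ℝ≥0 * h)) + k) ^ k)

/-- the route's `NNDivisionHard` (stmt-21181) over the library polynomial (definitionally the route's inlining). -/
def NNDivisionHardLit : Prop :=
  ∀ c : ℕ, ∃ n₀ : ℕ, ∀ n ≥ n₀, ∀ h : MvPolynomial (Fin (2 * n) × Fin (2 * n)) ℝ≥0, h ≠ 0 →
    T c n < complexity (nestFreeMatchingPoly n ℝ≥0 * h) + complexity h

/-- the closed rung 23918 `NNLinearDegreeCofactorHard` over the library polynomial (same shape). -/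
def NNLinearDegreeCofactorHardLit : Prop :=
  ∃ a : ℕ, ∀ c : ℕ, ∃ n₀ : ℕ, ∀ n ≥ n₀, ∀ h : MvPolynomial (Fin (2 * n) × Fin (2 * n)) ℝ≥0, h ≠ 0 →
    a * h.totalDegree ≤ n → T c n < complexity (nestFreeMatchingPoly n ℝ≥0 * h) + complexity h

/-! ## Proved spine -/

/-- N3 ⇒ 21181 (drop the uncharged `L₊(h)`). -/
theorem nnDivisionHard_of_multiples (hM : NNMultiplesHard) : NNDivisionHardLit := by
  intro c
  obtain ⟨n₀, hn₀⟩ := hM c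
  exact ⟨n₀, fun n hn h hh => lt_of_lt_of_le (hn₀ n hn h hh) (Nat.le_add_right _ _)⟩

/-- R2 ⇒ 23918-shape (with `a = 1`: `deg h ≤ n < 2^(log₂ n + 1)`). -/
theorem linearDegree_of_rung (hR : NNQuasiPolyLogDegreeCofactorHard) : NNLinearDegreeCofactorHardLit := by
  refine ⟨1, fun c => ?_⟩
  obtain ⟨n₀, hn₀⟩ := hR 1 c
  refine ⟨n₀, fun n hn h hh hdeg => ?_⟩
  have hlt : n < 2 ^ ((Nat.log 2 n + 1) ^ 1) := by
    rw [pow_one]; exact Nat.lt_pow_succ_log_self (by norm_num) n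
  exact lt_of_lt_of_le (hn₀ n hn h hh (by omega)) (Nat.le_add_right _ _)

/-- exponent bookkeeping: `(L + (L+c)^c + k)^k ≤ (L + k')^{k'}` with `k' = (c+1)k + c + k + 2`. -/
theorem exponent_bookkeeping (c k L : ℕ) :
    (L + (L + c) ^ c + k) ^ k ≤ (L + ((c + 1) * k + c + k + 2)) ^ ((c + 1) * k + c + k + 2) := by
  set y := L + c + k + 2 with hy
  have hy2 : 2 ≤ y := by omega
  have hyc : 1 ≤ y ^ c := Nat.one_le_pow _ _ (by omega)
  have h1 : (L + c) ^ c ≤ y ^ c := Nat.pow_le_pow_left (by omega) c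
  have h2 : L + k ≤ (L + k) * y ^ c := Nat.le_mul_of_pos_right _ (by omega)
  have hbase : L + (L + c) ^ c + k ≤ y ^ (c + 1) := by
    calc L + (L + c) ^ c + k ≤ y ^ c + (L + k) * y ^ c := by omega
      _ = (1 + (L + k)) * y ^ c := by ring
      _ ≤ y * y ^ c := Nat.mul_le_mul_right _ (by omega)
      _ = y ^ (c + 1) := by ring
  calc (L + (L + c) ^ c + k) ^ k ≤ (y ^ (c + 1)) ^ k := Nat.pow_le_pow_left hbase k
    _ = y ^ ((c + 1) * k) := by rw [← pow_mul]
    _ ≤ y ^ ((c + 1) * k + c + k + 2) := Nat.pow_le_pow_right (by omega) (by omega)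
    _ ≤ (L + ((c + 1) * k + c + k + 2)) ^ ((c + 1) * k + c + k + 2) :=
        Nat.pow_le_pow_left (by omega) _

/-- **R2 + N2 ⇒ N3** (the NN twin of the logic of `DivisionGap.ShadowCofactorSplit`, division side; kernel-checked):
if multiples of quasi-polynomial degree are hard and every cheap multiple yields a cheap multiple of quasi-polynomial
degree, then ALL multiples are hard. -/
theorem multiples_of_rung_of_reduction (hR : NNQuasiPolyLogDegreeCofactorHard)
    (hD : NNCofactorDegreeReduction) : NNMultiplesHard := by
  intro c
  obtain ⟨k, hk⟩ := hD
  set k' := (c + 1) * k + c + k + 2 with hk'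
  obtain ⟨n₀, hn₀⟩ := hR k' k'
  refine ⟨n₀, fun n hn h hh => ?_⟩
  by_contra hs
  push Not at hs
  -- `s := L₊(NN·h) ≤ T c n`, so `log₂ s ≤ (log₂ n + c)^c`
  have hlog : Nat.log 2 (complexity (nestFreeMatchingPoly n ℝ≥0 * h)) ≤ (Nat.log 2 n + c) ^ c := by
    calc Nat.log 2 (complexity (nestFreeMatchingPoly n ℝ≥0 * h)) ≤ Nat.log 2 (T c n) := Nat.log_mono_right hs
      _ = (Nat.log 2 n + c) ^ c := Nat.log_pow (by norm_num) _
  obtain ⟨h', hh', hdeg', hcomp'⟩ := hk n h hh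
  have hE : (Nat.log 2 n + Nat.log 2 (complexity (nestFreeMatchingPoly n ℝ≥0 * h)) + k) ^ k ≤
      (Nat.log 2 n + k') ^ k' := by
    calc (Nat.log 2 n + Nat.log 2 (complexity (nestFreeMatchingPoly n ℝ≥0 * h)) + k) ^ k
        ≤ (Nat.log 2 n + (Nat.log 2 n + c) ^ c + k) ^ k := Nat.pow_le_pow_left (by omega) k
      _ ≤ (Nat.log 2 n + k') ^ k' := exponent_bookkeeping c k (Nat.log 2 n)
  have hpow : 2 ^ ((Nat.log 2 n + Nat.log 2 (complexity (nestFreeMatchingPoly n ℝ≥0 * h)) + k) ^ k) ≤ T k' n :=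
    Nat.pow_le_pow_right (by norm_num) hE
  have hlt := hn₀ n hn h' hh' (hdeg'.trans hpow)
  exact absurd (lt_of_lt_of_le hlt (hcomp'.trans hpow)) (lt_irrefl _)

/-! ## ORDER upgrade (rev 7, PROVED): R2 ⇒ R2ᵒ, N2 ⇒ N2♯, R2ᵒ + N2♯ ⇒ N3 -/

theorem homogeneousComponent_nn_mul (n d : ℕ) (h : MvPolynomial (Fin (2 * n) × Fin (2 * n)) ℝ≥0) :
    homogeneousComponent (n + d) (nestFreeMatchingPoly n ℝ≥0 * h) =
      nestFreeMatchingPoly n ℝ≥0 * homogeneousComponent d h :=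
  weightedHomogeneousComponent_mul_left (nestFreeMatchingPoly_isHomogeneous n) h d

/-- exponent bookkeeping for the order upgrade: `(n + d + 2)² · T c n ≤ T (c+k+2) n` once `n ≥ 2⁹`. -/
theorem order_bookkeeping (k c n d : ℕ) (hn : 2 ^ 9 ≤ n) (hd : d ≤ 2 ^ ((Nat.log 2 n + k) ^ k)) :
    (n + d + 2) ^ 2 * T c n ≤ T (c + k + 2) n := by
  set L := Nat.log 2 n with hL
  have hL9 : 9 ≤ L := by
    rw [hL]; exact Nat.le_log_of_pow_le (by norm_num) hn
  set E := (L + k) ^ k + L + 1 with hE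
  have hnlt : n < 2 ^ (L + 1) := Nat.lt_pow_succ_log_self (by norm_num) n
  have h2E : 2 ^ (L + 1) ≤ 2 ^ E := Nat.pow_le_pow_right (by norm_num) (by omega)
  have hdE : 2 ^ ((L + k) ^ k) ≤ 2 ^ E := Nat.pow_le_pow_right (by norm_num) (by omega)
  have h1E : 2 ≤ 2 ^ E := by
    calc (2:ℕ) = 2 ^ 1 := by norm_num
      _ ≤ 2 ^ E := Nat.pow_le_pow_right (by norm_num) (by omega)
  have hsum : n + d + 2 ≤ 4 * 2 ^ E := by omega
  have hsq : (n + d + 2) ^ 2 ≤ 2 ^ (2 * E + 4) := by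
    calc (n + d + 2) ^ 2 ≤ (4 * 2 ^ E) ^ 2 := Nat.pow_le_pow_left hsum 2
      _ = 2 ^ (2 * E + 4) := by
        rw [mul_pow, ← pow_mul, show (4:ℕ) ^ 2 = 2 ^ 4 by norm_num, ← pow_add]; ring_nf
  set A := L + c + k + 2 with hA
  have hA11 : 11 ≤ A := by omega
  have hApos : 0 < A := by omega
  have hm : c + k + 1 ≠ 0 := by omega
  have hAc : (L + c) ^ c ≤ A ^ (c + k + 1) :=
    (Nat.pow_le_pow_left (by omega) c).trans (Nat.pow_le_pow_right hApos (by omega))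
  have hAk : (L + k) ^ k ≤ A ^ (c + k + 1) :=
    (Nat.pow_le_pow_left (by omega) k).trans (Nat.pow_le_pow_right hApos (by omega))
  have hAL : L ≤ A ^ (c + k + 1) := (show L ≤ A by omega).trans (Nat.le_self_pow hm A)
  have hA1 : 1 ≤ A ^ (c + k + 1) := Nat.one_le_pow _ _ hApos
  have hexp : 2 * E + 4 + (L + c) ^ c ≤ A ^ (c + k + 2) := by
    calc 2 * E + 4 + (L + c) ^ c = 2 * (L + k) ^ k + 2 * L + 6 + (L + c) ^ c := by rw [hE]; ring
      _ ≤ 2 * A ^ (c + k + 1) + 2 * A ^ (c + k + 1) + 6 * A ^ (c + k + 1) + A ^ (c + k + 1) := by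
          have := Nat.mul_le_mul_left 6 hA1; omega
      _ = 11 * A ^ (c + k + 1) := by ring
      _ ≤ A * A ^ (c + k + 1) := Nat.mul_le_mul_right _ hA11
      _ = A ^ (c + k + 2) := by ring
  calc (n + d + 2) ^ 2 * T c n ≤ 2 ^ (2 * E + 4) * 2 ^ ((L + c) ^ c) := Nat.mul_le_mul_right _ hsq
    _ = 2 ^ (2 * E + 4 + (L + c) ^ c) := by rw [← pow_add]
    _ ≤ 2 ^ (A ^ (c + k + 2)) := Nat.pow_le_pow_right (by norm_num) hexp
    _ = T (c + k + 2) n := by rw [hA]; simp only [T]; ring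

/-- **R2 ⇒ R2ᵒ** (kernel-checked): the DEGREE hypothesis of the rung relaxes to an ORDER hypothesis — apply R2 to
the nonzero homogeneous component `h^{(d)}`, then `L₊(NN_n · h^{(d)}) = L₊((NN_n·h)^{(n+d)}) ≤ (n+d+2)² · L₊(NN_n·h)`. -/
theorem orderRung_of_rung (hR : NNQuasiPolyLogDegreeCofactorHard) : NNQuasiPolyLogOrderCofactorHard := by
  intro k c
  obtain ⟨n₀, hn₀⟩ := hR k (c + k + 2)
  refine ⟨max n₀ (2 ^ 9), fun n hn h d hd hdk => ?_⟩
  have hn0 : n₀ ≤ n := le_of_max_le_left hn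
  have hn9 : 2 ^ 9 ≤ n := le_of_max_le_right hn
  have hdeg : (homogeneousComponent d h).totalDegree ≤ 2 ^ ((Nat.log 2 n + k) ^ k) :=
    (homogeneousComponent_isHomogeneous d h).totalDegree_le.trans hdk
  have h1 := hn₀ n hn0 (homogeneousComponent d h) hd hdeg
  rw [← homogeneousComponent_nn_mul] at h1
  have h2 := complexity_homogeneousComponent_le_sq_mul (nestFreeMatchingPoly n ℝ≥0 * h) (n + d)
  have h3 := order_bookkeeping k c n d hn9 hdk
  by_contra hlt
  push Not at hlt
  have h4 : (n + d + 2) ^ 2 * complexity (nestFreeMatchingPoly n ℝ≥0 * h) ≤ (n + d + 2) ^ 2 * T c n :=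
    Nat.mul_le_mul_left _ hlt
  omega

/-- corollary of R2ᵒ: cofactors with a nonzero CONSTANT TERM, of any degree (`h = 1 + g`, …). -/
theorem constantTerm_cofactor_hard (hR : NNQuasiPolyLogDegreeCofactorHard) :
    ∀ c : ℕ, ∃ n₀ : ℕ, ∀ n ≥ n₀, ∀ h : MvPolynomial (Fin (2 * n) × Fin (2 * n)) ℝ≥0,
      constantCoeff h ≠ 0 → T c n < complexity (nestFreeMatchingPoly n ℝ≥0 * h) := by
  intro c
  obtain ⟨n₀, hn₀⟩ := orderRung_of_rung hR 0 c
  refine ⟨n₀, fun n hn h hh => hn₀ n hn h 0 ?_ (Nat.zero_le _)⟩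
  rw [homogeneousComponent_zero]
  intro h0
  apply hh
  have := congrArg constantCoeff h0
  rw [constantCoeff_C, map_zero] at this
  exact this

/-- a nonzero polynomial has a nonzero homogeneous component of degree `≤` its total degree -/
theorem exists_homogeneousComponent_ne_zero {σ : Type} (p : MvPolynomial σ ℝ≥0) (hp : p ≠ 0) :
    ∃ d ≤ p.totalDegree, homogeneousComponent d p ≠ 0 := by
  classical
  by_contra hall
  push Not at hall
  apply hp
  rw [← sum_homogeneousComponent p]
  exact Finset.sum_eq_zero fun d hd => hall d (Nat.lt_succ_iff.1 (Finset.mem_range.1 hd))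

/-- **N2 ⇒ N2♯**: the order-reduction residual is WEAKER than the degree-reduction residual. -/
theorem orderReduction_of_reduction (hD : NNCofactorDegreeReduction) : NNCofactorOrderReduction := by
  obtain ⟨k, hk⟩ := hD
  refine ⟨k, fun n h hh => ?_⟩
  obtain ⟨h', hh', hdeg', hcomp'⟩ := hk n h hh
  obtain ⟨d, hd, hne⟩ := exists_homogeneousComponent_ne_zero h' hh'
  exact ⟨h', d, hne, hd.trans hdeg', hcomp'⟩

/-- **R2ᵒ + N2♯ ⇒ N3** (same exponent bookkeeping as `multiples_of_rung_of_reduction`). -/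
theorem multiples_of_orderRung_of_orderReduction (hR : NNQuasiPolyLogOrderCofactorHard)
    (hD : NNCofactorOrderReduction) : NNMultiplesHard := by
  intro c
  obtain ⟨k, hk⟩ := hD
  set k' := (c + 1) * k + c + k + 2 with hk'
  obtain ⟨n₀, hn₀⟩ := hR k' k'
  refine ⟨n₀, fun n hn h hh => ?_⟩
  by_contra hs
  push Not at hs
  have hlog : Nat.log 2 (complexity (nestFreeMatchingPoly n ℝ≥0 * h)) ≤ (Nat.log 2 n + c) ^ c := by
    calc Nat.log 2 (complexity (nestFreeMatchingPoly n ℝ≥0 * h)) ≤ Nat.log 2 (T c n) := Nat.log_mono_right hs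
      _ = (Nat.log 2 n + c) ^ c := Nat.log_pow (by norm_num) _
  obtain ⟨h', d, hne, hd, hcomp'⟩ := hk n h hh
  have hE : (Nat.log 2 n + Nat.log 2 (complexity (nestFreeMatchingPoly n ℝ≥0 * h)) + k) ^ k ≤
      (Nat.log 2 n + k') ^ k' := by
    calc (Nat.log 2 n + Nat.log 2 (complexity (nestFreeMatchingPoly n ℝ≥0 * h)) + k) ^ k
        ≤ (Nat.log 2 n + (Nat.log 2 n + c) ^ c + k) ^ k := Nat.pow_le_pow_left (by omega) k
      _ ≤ (Nat.log 2 n + k') ^ k' := exponent_bookkeeping c k (Nat.log 2 n)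
  have hpow : 2 ^ ((Nat.log 2 n + Nat.log 2 (complexity (nestFreeMatchingPoly n ℝ≥0 * h)) + k) ^ k) ≤ T k' n :=
    Nat.pow_le_pow_right (by norm_num) hE
  have hlt := hn₀ n hn h' d hne (hd.trans hpow)
  exact absurd (lt_of_lt_of_le hlt (hcomp'.trans hpow)) (lt_irrefl _)

/-! ## A1 (DISCHARGED, rev 8), G♭ = item 27045 (CLOSED; a theorem here since rev 9 — no `sorry` remains), and the proved transfers T1, T2, G♭ ⇒ G -/

section A1Discharge

open Summit.ValiantsHypothesis.ValiantsHypothesis.Theorems.FifoMatching.QueueGridFace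
  (realSupport_nestFreeMatchingPoly arcExponent_arc arc_of_arcExponent_ne_zero)
open Summit.ValiantsHypothesis.ValiantsHypothesis.Theorems.FifoMatching.NFPolytopeQuasiPolyXC.QueueGridFace
  (half coordMap design_mem_nestFreeMatchings design_mem_allowed exists_design_eq coordMap_arc_iff)

/-- **Point form of the face–projection reduction (rev 8; the A1 glue, formerly price P2).**  Gadget data exactly as in
c1 g5's `QueueGridFace.face_projection_of_gadget_prop` (p612281) — (h1) designs are nest-free perfect matchings, (h2)
supported on `E'`, (h3) RIGIDITY, (h4) `Prop` read-out: then the 0/1 POINTS of `supp NN_n` on the coordinate face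
`{x_a = 0 : a ∉ E'}` are mapped by `x ↦ x ∘ f` EXACTLY onto the pattern vectors `X ↦ (q ↦ [C X q])`.  (c1's theorem is the
convex-HULL form; the shadow lift T2 needs the points, HY21 Lemma 10.) [folklore assembly] -/
theorem zeroOnePoints_of_gadget_prop {n : ℕ} {β κ : Type*}
    (dsg : β → (Fin (2 * n) → Fin (2 * n))) (E' : Set (Fin (2 * n) × Fin (2 * n)))
    (f : κ → Fin (2 * n) × Fin (2 * n)) (C : β → κ → Prop) [∀ X q, Decidable (C X q)]
    (h1 : ∀ X, dsg X ∈ nestFreeMatchings (2 * n))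
    (h2 : ∀ X i, i < dsg X i → (i, dsg X i) ∈ E')
    (h3 : ∀ M ∈ nestFreeMatchings (2 * n), (∀ i, i < M i → (i, M i) ∈ E') → ∃ X, dsg X = M)
    (h4 : ∀ X q, ((f q).1 < dsg X (f q).1 ∧ dsg X (f q).1 = (f q).2) ↔ C X q) :
    ∃ Z : Finset (Fin (2 * n) × Fin (2 * n)),
      (fun x : (Fin (2 * n) × Fin (2 * n)) → ℝ => x ∘ f) ''
          (suppPts (nestFreeMatchingPoly n ℝ≥0) ∩ {x | ∀ e ∈ Z, x e = 0})
        = Set.range (fun (X : β) (q : κ) => if C X q then (1 : ℝ) else 0) := by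
  classical
  let χ : (Fin (2 * n) → Fin (2 * n)) → (Fin (2 * n) × Fin (2 * n)) → ℝ :=
    fun M i => ((arcExponent M i : ℕ) : ℝ)
  refine ⟨Finset.univ.filter fun a => a ∉ E', ?_⟩
  -- the real support points are the `χ_M` (c1's `realSupport_nestFreeMatchingPoly`)
  have hsupp : suppPts (nestFreeMatchingPoly n ℝ≥0)
      = χ '' (nestFreeMatchings (2 * n) : Set (Fin (2 * n) → Fin (2 * n))) := by
    show (fun d : (Fin (2 * n) × Fin (2 * n)) →₀ ℕ => fun i : Fin (2 * n) × Fin (2 * n) => ((d i : ℕ) : ℝ)) ''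
        ((nestFreeMatchingPoly n ℝ≥0).support : Set ((Fin (2 * n) × Fin (2 * n)) →₀ ℕ)) = _
    rw [realSupport_nestFreeMatchingPoly]
  -- the read-out as values of `χ`
  have hread : ∀ X q, χ (dsg X) (f q) = if C X q then (1 : ℝ) else 0 := by
    intro X q
    have happ := arcExponent_apply (dsg X) (f q).1 (f q).2
    rw [Prod.mk.eta] at happ
    simp only [χ, happ]
    by_cases hC : C X q
    · rw [if_pos ((h4 X q).2 hC), if_pos hC, Nat.cast_one]
    · rw [if_neg (fun h => hC ((h4 X q).1 h)), if_neg hC, Nat.cast_zero]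
  rw [hsupp]
  ext y
  simp only [Set.mem_image, Set.mem_inter_iff, Set.mem_setOf_eq, Finset.mem_filter, Finset.mem_univ, true_and,
    Set.mem_range]
  constructor
  · rintro ⟨x, ⟨⟨M, hM, rfl⟩, hx0⟩, rfl⟩
    have harcs : ∀ i, i < M i → (i, M i) ∈ E' := by
      intro i hi
      by_contra hni
      have h0 := hx0 (i, M i) hni
      simp only [χ, arcExponent_arc M hi, Nat.cast_one] at h0
      exact one_ne_zero h0
    obtain ⟨X, hX⟩ := h3 M (Finset.mem_coe.1 hM) harcs
    refine ⟨X, ?_⟩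
    funext q
    rw [← hX]
    exact (hread X q).symm
  · rintro ⟨X, rfl⟩
    refine ⟨χ (dsg X), ⟨⟨dsg X, Finset.mem_coe.2 (h1 X), rfl⟩, fun e he => ?_⟩, ?_⟩
    · simp only [χ, Nat.cast_eq_zero]
      by_contra hne
      obtain ⟨hlt, heq⟩ := arc_of_arcExponent_ne_zero (dsg X) hne
      have hmem := h2 X _ hlt
      rw [heq, Prod.mk.eta] at hmem
      exact he hmem
    · funext q
      exact hread X q

/-- **A1 `QueueGridZeroOnePoints` DISCHARGED (rev 8)** from val-width-26254-qg1 g0's landed layout-B gadget facts — the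
same instantiation as the landed `queueGridFaceProjection` (p617795): designs `design d X`
(`design_mem_nestFreeMatchings`), allowed arcs `allowed r d` (`design_mem_allowed`), RIGIDITY `exists_design_eq`,
read-out `coordMap_arc_iff`.  No item needed (tenure, vw l.1281: A1 is a stub, not itemised). -/
theorem queueGridZeroOnePoints_holds : QueueGridZeroOnePoints := by
  intro r n _ hn
  obtain ⟨d, rfl⟩ := Nat.exists_eq_add_of_le hn
  obtain ⟨Z, h⟩ := zeroOnePoints_of_gadget_prop (n := half r d)
    (Summit.ValiantsHypothesis.ValiantsHypothesis.Theorems.FifoMatching.NFPolytopeQuasiPolyXC.QueueGridFace.design d)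
    (Summit.ValiantsHypothesis.ValiantsHypothesis.Theorems.FifoMatching.NFPolytopeQuasiPolyXC.QueueGridFace.allowed r d :
      Set (Fin (2 * half r d) × Fin (2 * half r d))) (coordMap r d)
    (fun X q => qgEdge r q.1 = true ∧ X q.1.1 = q.2.1 ∧ X q.1.2 = q.2.2)
    (fun X => design_mem_nestFreeMatchings X)
    (fun X i hi => Finset.mem_coe.2 (design_mem_allowed X i hi))
    (fun M hM hE => exists_design_eq M hM fun p hp => Finset.mem_coe.1 (hE p hp))
    (fun X q => coordMap_arc_iff X q)
  exact ⟨Z, coordMap r d, h⟩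

end A1Discharge

/-- **A1 — formerly the stub shared with the K1 line; since rev 8 a THEOREM** (`queueGridZeroOnePoints_holds`).  The
name is kept because the registered skeleton and the compositions below refer to it. -/
theorem stub_zeroOnePoints : QueueGridZeroOnePoints :=
  queueGridZeroOnePoints_holds

/-- **G♭ — formerly the line's last stub; since rev 9 a THEOREM.**  The AFHMS clique face (arXiv:1806.00541 pp. 5–6) =
route item stmt-ValiantsHypothesis-27045 `Theses.FifoMatching.GridCorCliqueFace` (FORM A), CLOSED·proved 2026-08-28T09:44Z
(p622413 `gridCorCliqueFace_holds`, port-4 g1) on the Literature chain G1–G6 of p10 g2 / p9 g1 / p4 g12 (last file p621663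
`Literature/Combinatorics/Optimization/GridCorCliqueFace.lean`); consumed here BY NAME from the Literature theorem whose
statement is the item's body verbatim.  The name `stub_cliqueFace` is kept because the registered skeleton and the
compositions below refer to it.  G follows: `gridCorShadowHard_of_cliqueFace`. -/
theorem stub_cliqueFace : GridCorCliqueFace :=
  Literature.Combinatorics.Optimization.AboulkerEtAl2019_gridCorCliqueFace

/-- **T1, PROVED (rev 3)** — shadows pull back along c1's PROVED linear read-out `corMap r ⌊r/2⌋ : PP_r ↠ COR(G_{⌊r/2⌋})`
(p615220 `range_corMap_patternVec`, consumed by name; bridge `corVec_eq_corVertex`): `(L ∘ corMap) '' range(patternVec r) = L '' range(corVertex)`, the same polygon; threshold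
shift `(log₂ r + c)^c ≤ (log₂ ⌊r/2⌋ + (c+1))^{c+1}` for `r ≥ 2`. -/
theorem ppShadow_of_grid (hG : GridCorShadowHard) : PPShadowHard := by
  intro c
  obtain ⟨t₀, ht₀⟩ := hG (c + 1)
  refine ⟨2 * t₀ + 2, fun r hr => ?_⟩
  have hg : 2 * (r / 2) ≤ r := Nat.mul_div_le r 2
  have hgt : t₀ ≤ r / 2 := by omega
  obtain ⟨L, hL⟩ := ht₀ (r / 2) hgt
  refine ⟨L ∘ₗ corMap r (r / 2) hg, ?_⟩
  have hcv : Set.range (corVec (gridGraph (r / 2))) = Set.range (corVertex (gridGraph (r / 2))) :=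
    congrArg Set.range (funext (corVec_eq_corVertex (gridGraph (r / 2))))
  have himg : (L ∘ₗ corMap r (r / 2) hg) '' Set.range (patternVec r) =
      L '' Set.range (corVec (gridGraph (r / 2))) := by
    rw [hcv, LinearMap.coe_comp, Set.image_comp, ← Set.range_comp,
      show Set.range (⇑(corMap r (r / 2) hg) ∘ patternVec r) = Set.range (corVertex (gridGraph (r / 2))) from
        range_corMap_patternVec r (r / 2) hg]
  have hverts : shadowVerts (Set.range (patternVec r)) (L ∘ₗ corMap r (r / 2) hg) =
      shadowVerts (Set.range (corVec (gridGraph (r / 2)))) L := by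
    unfold shadowVerts
    rw [himg]
  rw [hverts]
  refine lt_of_le_of_lt ?_ hL
  -- threshold shift: `T c r ≤ T (c+1) (r/2)`
  have hlog : Nat.log 2 (r / 2) = Nat.log 2 r - 1 := Nat.log_div_base 2 r
  have hℓ1 : 1 ≤ Nat.log 2 r := Nat.log_pos (by norm_num) (by omega)
  apply Nat.pow_le_pow_right Nat.two_pos
  rw [hlog]
  calc (Nat.log 2 r + c) ^ c ≤ (Nat.log 2 r - 1 + (c + 1)) ^ c :=
        Nat.pow_le_pow_left (by omega) c
    _ ≤ (Nat.log 2 r - 1 + (c + 1)) ^ (c + 1) := Nat.pow_le_pow_right (by omega) (by omega)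

/-! ## T2 — the face lift, PROVED (rev 4).  Geometric core: uniquely-maximised points of a homogeneous pencil are
vertices (`um_subset_extremePoints`, exposed ⇒ extreme); HY21 Prop 23's four coordinate pencils cover all vertices
(`Literature…HrubesYehudayoff2021Prop23.extremePoints_subset_um4`), so a shadow with `> 4B` vertices has a pencil uniquely
maximised at `> B` points (`exists_pencil_of_many_vertices`); and THE LIFT `um_lift` (general modules, any linear face
functional `ψ ∈ {0} ∪ [1,∞)` on `S`): `L := Λ ∘ ρ − (K·ψ) • e` with `c e = 1`, `d e = 0` keeps every uniquely-maximised point of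
the face shadow uniquely maximised (off-face points are pushed below by `K`) — loss-free per pencil, factor `4` overall
(`shadow_faceLift_count`), no halving argument; reusable verbatim for the minor step of crux G. -/

section FaceLiftGeo

local notation3 (prettyPrint := false) "UM[" c ", " d ", " X "]" =>
  {p | p ∈ X ∧ ∃ t : ℝ, ∀ q ∈ X, q ≠ p → c q + t * d q < c p + t * d p}

variable {G : Type*} [AddCommGroup G] [Module ℝ G]

/-- an additive functional that is `ℝ`-homogeneous is a linear map -/
def linOf (c : G →+ ℝ) (hc : ∀ (a : ℝ) (x : G), c (a • x) = a * c x) : G →ₗ[ℝ] ℝ :=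
  { toFun := c, map_add' := c.map_add, map_smul' := fun a x => by rw [hc]; rfl }

@[simp] theorem linOf_apply (c : G →+ ℝ) (hc) (x : G) : linOf c hc x = c x := rfl

/-- **Uniquely maximised ⇒ extreme.** If `p ∈ X` strictly maximises the linear functional `g` over `X ∖ {p}`,
then `p` is an extreme point of `conv X`. [folklore: exposed points are extreme] -/
theorem mem_extremePoints_of_strict_max (X : Set G) (g : G →ₗ[ℝ] ℝ) {p : G} (hp : p ∈ X)
    (hmax : ∀ q ∈ X, q ≠ p → g q < g p) :
    p ∈ Set.extremePoints ℝ (convexHull ℝ X) := by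
  classical
  -- every point of `conv X` has `g ≤ g p`, with equality only at `p`
  have hle : ∀ q ∈ X, g q ≤ g p := fun q hq => by
    by_cases h : q = p
    · rw [h]
    · exact (hmax q hq h).le
  have key : ∀ x ∈ convexHull ℝ X, g x ≤ g p ∧ (g x = g p → x = p) := by
    intro x hx
    rw [_root_.convexHull_eq] at hx
    obtain ⟨κ, t, w, z, hw0, hw1, hz, rfl⟩ := hx
    have hcm : t.centerMass w z = ∑ i ∈ t, w i • z i := Finset.centerMass_eq_of_sum_1 _ _ hw1
    have hg : g (t.centerMass w z) = ∑ i ∈ t, w i * g (z i) := by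
      rw [hcm, map_sum]
      simp [map_smul, smul_eq_mul]
    have hsum_le : ∑ i ∈ t, w i * g (z i) ≤ ∑ i ∈ t, w i * g p :=
      Finset.sum_le_sum fun i hi => mul_le_mul_of_nonneg_left (hle _ (hz i hi)) (hw0 i hi)
    have hsum_p : ∑ i ∈ t, w i * g p = g p := by rw [← Finset.sum_mul, hw1, one_mul]
    refine ⟨by rw [hg]; linarith, fun heq => ?_⟩
    -- equality: every `z i` with positive weight is `p`
    have hzero : ∀ i ∈ t, w i ≠ 0 → z i = p := by
      intro i hi hwi
      by_contra hne
      have hlt : w i * g (z i) < w i * g p :=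
        mul_lt_mul_of_pos_left (hmax _ (hz i hi) hne) (lt_of_le_of_ne (hw0 i hi) (Ne.symm hwi))
      have : ∑ j ∈ t, w j * g (z j) < ∑ j ∈ t, w j * g p :=
        Finset.sum_lt_sum (fun j hj => mul_le_mul_of_nonneg_left (hle _ (hz j hj)) (hw0 j hj)) ⟨i, hi, hlt⟩
      rw [hg] at heq
      linarith
    rw [← Finset.centerMass_filter_ne_zero]
    have hw1' : ∑ i ∈ t.filter (fun i => w i ≠ 0), w i = 1 := by rw [Finset.sum_filter_ne_zero, hw1]
    rw [Finset.centerMass_eq_of_sum_1 _ _ hw1']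
    calc ∑ i ∈ t.filter (fun i => w i ≠ 0), w i • z i
        = ∑ i ∈ t.filter (fun i => w i ≠ 0), w i • p := by
          refine Finset.sum_congr rfl fun i hi => ?_
          obtain ⟨hit, hwi⟩ := Finset.mem_filter.mp hi
          rw [hzero i hit hwi]
      _ = p := by rw [← Finset.sum_smul, hw1', one_smul]
  rw [mem_extremePoints]
  refine ⟨subset_convexHull ℝ X hp, fun x₁ hx₁ x₂ hx₂ hseg => ?_⟩
  obtain ⟨a, b, ha, hb, hab, hpx⟩ := hseg
  have h1 := key x₁ hx₁
  have h2 := key x₂ hx₂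
  have hgp : g p = a * g x₁ + b * g x₂ := by
    rw [← hpx, map_add, map_smul, map_smul, smul_eq_mul, smul_eq_mul]
  have hsum : a * (g p - g x₁) + b * (g p - g x₂) = 0 := by linear_combination (g p) * hab + hgp
  have t1 : 0 ≤ a * (g p - g x₁) := mul_nonneg ha.le (by linarith [h1.1])
  have t2 : 0 ≤ b * (g p - g x₂) := mul_nonneg hb.le (by linarith [h2.1])
  have z1 : a * (g p - g x₁) = 0 := by linarith
  have z2 : b * (g p - g x₂) = 0 := by linarith
  have e1 : g x₁ = g p := by
    have := (mul_eq_zero.1 z1).resolve_left ha.ne'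
    linarith
  have e2 : g x₂ = g p := by
    have := (mul_eq_zero.1 z2).resolve_left hb.ne'
    linarith
  exact ⟨h1.2 e1, h2.2 e2⟩

/-- uniquely maximised points of a homogeneous pencil are extreme points of the hull. -/
theorem um_subset_extremePoints (X : Set G) (c d : G →+ ℝ)
    (hc : ∀ (a : ℝ) (x : G), c (a • x) = a * c x) (hd : ∀ (a : ℝ) (x : G), d (a • x) = a * d x) :
    UM[c, d, X] ⊆ Set.extremePoints ℝ (convexHull ℝ X) := by
  rintro p ⟨hp, t, ht⟩
  refine mem_extremePoints_of_strict_max X (linOf c hc + t • linOf d hd) hp fun q hq hne => ?_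
  simpa using ht q hq hne

/-- the four coordinate pencils cover the vertices: some pencil is uniquely maximised at `> B` points
whenever there are `> 4 B` vertices. -/
theorem exists_pencil_of_many_vertices (T : Set (Fin 2 → ℝ)) (hT : T.Finite) (B : ℕ)
    (hB : 4 * B < (Set.extremePoints ℝ (convexHull ℝ T)).ncard) :
    ∃ (c d : (Fin 2 → ℝ) →+ ℝ) (e : Fin 2 → ℝ),
      (∀ (a : ℝ) (x : Fin 2 → ℝ), c (a • x) = a * c x) ∧ (∀ (a : ℝ) (x : Fin 2 → ℝ), d (a • x) = a * d x) ∧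
      c e = 1 ∧ d e = 0 ∧ B < (UM[c, d, T]).ncard := by
  classical
  let c₀ : (Fin 2 → ℝ) →+ ℝ := Pi.evalAddMonoidHom (fun _ : Fin 2 => ℝ) 0
  let c₁ : (Fin 2 → ℝ) →+ ℝ := Pi.evalAddMonoidHom (fun _ : Fin 2 => ℝ) 1
  have hc₀ : ∀ x, c₀ x = x 0 := fun x => rfl
  have hc₁ : ∀ x, c₁ x = x 1 := fun x => rfl
  have h4 := HrubesYehudayoff2021Prop23.extremePoints_subset_um4 c₀ c₁ hc₀ hc₁ T hT
  -- finiteness of the four UM sets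
  have hf : ∀ (c d : (Fin 2 → ℝ) →+ ℝ), (UM[c, d, T]).Finite := fun c d => hT.subset fun p hp => hp.1
  have hsum : (Set.extremePoints ℝ (convexHull ℝ T)).ncard ≤
      (UM[c₀, c₁, T]).ncard + (UM[(-c₀), c₁, T]).ncard + (UM[c₁, c₀, T]).ncard + (UM[(-c₁), c₀, T]).ncard := by
    calc (Set.extremePoints ℝ (convexHull ℝ T)).ncard
        ≤ (UM[c₀, c₁, T] ∪ UM[(-c₀), c₁, T] ∪ UM[c₁, c₀, T] ∪ UM[(-c₁), c₀, T]).ncard :=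
          Set.ncard_le_ncard h4 ((((hf _ _).union (hf _ _)).union (hf _ _)).union (hf _ _))
      _ ≤ (UM[c₀, c₁, T] ∪ UM[(-c₀), c₁, T] ∪ UM[c₁, c₀, T]).ncard + (UM[(-c₁), c₀, T]).ncard :=
          Set.ncard_union_le _ _
      _ ≤ (UM[c₀, c₁, T] ∪ UM[(-c₀), c₁, T]).ncard + (UM[c₁, c₀, T]).ncard + (UM[(-c₁), c₀, T]).ncard := by
          gcongr; exact Set.ncard_union_le _ _
      _ ≤ _ := by gcongr; exact Set.ncard_union_le _ _
  -- homogeneity of (±) coordinate functionals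
  have hom₀ : ∀ (a : ℝ) (x : Fin 2 → ℝ), c₀ (a • x) = a * c₀ x := fun a x => by simp [hc₀]
  have hom₁ : ∀ (a : ℝ) (x : Fin 2 → ℝ), c₁ (a • x) = a * c₁ x := fun a x => by simp [hc₁]
  have homn₀ : ∀ (a : ℝ) (x : Fin 2 → ℝ), (-c₀) (a • x) = a * (-c₀) x := fun a x => by
    simp [hc₀]
  have homn₁ : ∀ (a : ℝ) (x : Fin 2 → ℝ), (-c₁) (a • x) = a * (-c₁) x := fun a x => by
    simp [hc₁]
  -- the four unit vectors
  let e₀ : Fin 2 → ℝ := Pi.single 0 1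
  let e₁ : Fin 2 → ℝ := Pi.single 1 1
  by_cases h1 : B < (UM[c₀, c₁, T]).ncard
  · exact ⟨c₀, c₁, e₀, hom₀, hom₁, by simp [hc₀, e₀], by simp [hc₁, e₀], h1⟩
  by_cases h2 : B < (UM[(-c₀), c₁, T]).ncard
  · exact ⟨-c₀, c₁, -e₀, homn₀, hom₁, by simp [hc₀, e₀], by simp [hc₁, e₀], h2⟩
  by_cases h3 : B < (UM[c₁, c₀, T]).ncard
  · exact ⟨c₁, c₀, e₁, hom₁, hom₀, by simp [hc₁, e₁], by simp [hc₀, e₁], h3⟩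
  by_cases h4' : B < (UM[(-c₁), c₀, T]).ncard
  · exact ⟨-c₁, c₀, -e₁, homn₁, hom₀, by simp [hc₁, e₁], by simp [hc₀, e₁], h4'⟩
  omega

/-- a valid inequality on a finite point set has a positive gap off its face. -/
theorem exists_face_gap {E : Type*} [AddCommGroup E] [Module ℝ E] (S : Set E) (hS : S.Finite)
    (w : E →ₗ[ℝ] ℝ) (w₀ : ℝ) (hvalid : ∀ x ∈ S, w x ≤ w₀) :
    ∃ γ : ℝ, 0 < γ ∧ ∀ x ∈ S, w x = w₀ ∨ w x + γ ≤ w₀ := by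
  classical
  let D : Finset ℝ := (hS.toFinset.image fun x => w₀ - w x).filter fun a => 0 < a
  by_cases hD : D.Nonempty
  · refine ⟨D.min' hD, ?_, fun x hx => ?_⟩
    · have := D.min'_mem hD
      exact (Finset.mem_filter.1 this).2
    · rcases (hvalid x hx).lt_or_eq with hlt | heq
      · right
        have hmem : w₀ - w x ∈ D :=
          Finset.mem_filter.2 ⟨Finset.mem_image.2 ⟨x, hS.mem_toFinset.2 hx, rfl⟩, by linarith⟩
        have := D.min'_le _ hmem
        linarith
      · exact Or.inl heq
  · refine ⟨1, one_pos, fun x hx => ?_⟩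
    rcases (hvalid x hx).lt_or_eq with hlt | heq
    · exact absurd ⟨w₀ - w x, Finset.mem_filter.2
        ⟨Finset.mem_image.2 ⟨x, hS.mem_toFinset.2 hx, rfl⟩, by linarith⟩⟩ hD
    · exact Or.inl heq

/-- the face of a hull cut out by a valid inequality is the hull of the points on it. -/
theorem convexHull_inter_face {E : Type*} [AddCommGroup E] [Module ℝ E] (S : Set E)
    (w : E →ₗ[ℝ] ℝ) (w₀ : ℝ) (hvalid : ∀ x ∈ S, w x ≤ w₀) :
    convexHull ℝ S ∩ {x | w x = w₀} = convexHull ℝ (S ∩ {x | w x = w₀}) := by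
  classical
  apply Set.Subset.antisymm
  · rintro x ⟨hx, hxw⟩
    rw [_root_.convexHull_eq] at hx
    obtain ⟨κ, t, c, z, hc0, hc1, hz, rfl⟩ := hx
    have hcm : t.centerMass c z = ∑ i ∈ t, c i • z i := Finset.centerMass_eq_of_sum_1 _ _ hc1
    have hwx : w (t.centerMass c z) = ∑ i ∈ t, c i * w (z i) := by
      rw [hcm, map_sum]; simp [map_smul, smul_eq_mul]
    have hle : ∀ i ∈ t, c i * w (z i) ≤ c i * w₀ := fun i hi =>
      mul_le_mul_of_nonneg_left (hvalid _ (hz i hi)) (hc0 i hi)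
    have hsum0 : ∑ i ∈ t, c i * w₀ = w₀ := by rw [← Finset.sum_mul, hc1, one_mul]
    have heq : ∀ i ∈ t, c i * w (z i) = c i * w₀ := by
      rw [← Finset.sum_eq_sum_iff_of_le hle]
      rw [← hwx, hsum0]; exact hxw
    have hface : ∀ i ∈ t, c i ≠ 0 → w (z i) = w₀ := fun i hi hci =>
      mul_left_cancel₀ hci (heq i hi)
    rw [← Finset.centerMass_filter_ne_zero]
    apply Finset.centerMass_mem_convexHull
    · intro i hi; exact hc0 i (Finset.mem_filter.mp hi).1
    · rw [Finset.sum_filter_ne_zero, hc1]; exact one_pos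
    · intro i hi
      obtain ⟨hit, hci⟩ := Finset.mem_filter.mp hi
      exact ⟨hz i hit, hface i hit hci⟩
  · apply convexHull_min
    · rintro x ⟨hxS, hxw⟩
      exact ⟨subset_convexHull ℝ S hxS, hxw⟩
    · intro x hx y hy a b ha hb hab
      refine ⟨(convex_convexHull ℝ S) hx.1 hy.1 ha hb hab, ?_⟩
      show w (a • x + b • y) = w₀
      have h1 : w x = w₀ := hx.2
      have h2 : w y = w₀ := hy.2
      rw [map_add, map_smul, map_smul, h1, h2, smul_eq_mul, smul_eq_mul, ← add_mul, hab, one_mul]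

/-- **The face lift** (HY21 Lemma 10 in point form, loss-free for a fixed pencil; valid-inequality version).  `S` a finite
point set in a real vector space `E`; `w x ≤ w₀` an inequality on `S` with a gap `γ > 0` off its face (automatic for finite `S`,
`exists_face_gap`); `ρ : E → F` a linear read-out taking the face points `S ∩ {w = w₀}` exactly onto `Y`; `Λ` a planar shadow
map of `F`; `(c,d)` a homogeneous pencil with a vector `e`, `c e = 1`, `d e = 0`.  Then the LINEAR map `L := Λ ∘ ρ + (K·w) • e`
(suitable `K`) carries a translate of `UM[c,d, Λ(Y)]` into `UM[c,d, L(S)]`: every uniquely maximised point of the face shadow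
stays uniquely maximised (off-face points are pushed below by `K γ`).  Reused for T2 (coordinate face of `NFP_n`) and for
G♭ ⇒ G (the AFHMS clique face of `COR(G_{t,t})`). -/
theorem um_lift_face {E F : Type*} [AddCommGroup E] [Module ℝ E] [AddCommGroup F] [Module ℝ F]
    (S : Set E) (hS : S.Finite) (w : E →ₗ[ℝ] ℝ) (w₀ γ : ℝ) (hγ : 0 < γ)
    (hwS : ∀ x ∈ S, w x = w₀ ∨ w x + γ ≤ w₀)
    (ρ : E →ₗ[ℝ] F) (Y : Set F) (hY : ρ '' (S ∩ {x | w x = w₀}) = Y)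
    (Λ : F →ₗ[ℝ] (Fin 2 → ℝ)) (c d : (Fin 2 → ℝ) →+ ℝ)
    (hc : ∀ (a : ℝ) (x : Fin 2 → ℝ), c (a • x) = a * c x) (hd : ∀ (a : ℝ) (x : Fin 2 → ℝ), d (a • x) = a * d x)
    (e : Fin 2 → ℝ) (hce : c e = 1) (hde : d e = 0) :
    ∃ (L : E →ₗ[ℝ] (Fin 2 → ℝ)) (v : Fin 2 → ℝ), (fun p => p + v) '' UM[c, d, Λ '' Y] ⊆ UM[c, d, L '' S] := by
  classical
  have hw1 : ∀ x ∈ S, ¬ w x = w₀ → w x + γ ≤ w₀ := fun x hx h => (hwS x hx).resolve_left h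
  -- witnesses and the constant `K`
  set U : Set (Fin 2 → ℝ) := UM[c, d, Λ '' Y] with hU
  have hYfin : Y.Finite := by rw [← hY]; exact (hS.subset Set.inter_subset_left).image _
  have hUfin : U.Finite := (hYfin.image Λ).subset fun p hp => hp.1
  let τ : (Fin 2 → ℝ) → ℝ := fun p => if h : p ∈ U then h.2.choose else 0
  have hτ : ∀ p ∈ U, ∀ q ∈ Λ '' Y, q ≠ p → c q + τ p * d q < c p + τ p * d p := by
    intro p hp
    have := hp.2.choose_spec
    simp only [τ, dif_pos hp]
    exact this
  let B : ℝ := ∑ p ∈ hUfin.toFinset, ∑ x ∈ hS.toFinset,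
    |c (Λ (ρ x)) + τ p * d (Λ (ρ x)) - (c p + τ p * d p)|
  have hB0 : 0 ≤ B := Finset.sum_nonneg fun p _ => Finset.sum_nonneg fun x _ => abs_nonneg _
  have hBbound : ∀ p ∈ U, ∀ x ∈ S,
      c (Λ (ρ x)) + τ p * d (Λ (ρ x)) - (c p + τ p * d p) ≤ B := by
    intro p hp x hx
    have h1 : |c (Λ (ρ x)) + τ p * d (Λ (ρ x)) - (c p + τ p * d p)| ≤
        ∑ x ∈ hS.toFinset, |c (Λ (ρ x)) + τ p * d (Λ (ρ x)) - (c p + τ p * d p)| :=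
      Finset.single_le_sum (f := fun x => |c (Λ (ρ x)) + τ p * d (Λ (ρ x)) - (c p + τ p * d p)|)
        (fun x _ => abs_nonneg _) (hS.mem_toFinset.2 hx)
    have h2 : ∑ x ∈ hS.toFinset, |c (Λ (ρ x)) + τ p * d (Λ (ρ x)) - (c p + τ p * d p)| ≤ B :=
      Finset.single_le_sum (f := fun p => ∑ x ∈ hS.toFinset,
          |c (Λ (ρ x)) + τ p * d (Λ (ρ x)) - (c p + τ p * d p)|)
        (fun p _ => Finset.sum_nonneg fun x _ => abs_nonneg _) (hUfin.mem_toFinset.2 hp)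
    have h3 := le_abs_self (c (Λ (ρ x)) + τ p * d (Λ (ρ x)) - (c p + τ p * d p))
    linarith
  let K : ℝ := (B + 1) / γ
  have hK0 : 0 ≤ K := div_nonneg (by linarith) hγ.le
  have hKγ : K * γ = B + 1 := div_mul_cancel₀ _ hγ.ne'
  -- the lifted shadow map and the translation vector
  let L : E →ₗ[ℝ] (Fin 2 → ℝ) := Λ ∘ₗ ρ + (K • w).smulRight e
  let v : Fin 2 → ℝ := (K * w₀) • e
  have hL : ∀ x, L x = Λ (ρ x) + (K * w x) • e := fun x => by
    simp [L, LinearMap.smulRight_apply, smul_eq_mul]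
  have hcL : ∀ x, c (L x) = c (Λ (ρ x)) + K * w x := fun x => by
    rw [hL, map_add, hc, hce, mul_one]
  have hdL : ∀ x, d (L x) = d (Λ (ρ x)) := fun x => by
    rw [hL, map_add, hd, hde, mul_zero, add_zero]
  have hcv : ∀ p : Fin 2 → ℝ, c (p + v) = c p + K * w₀ := fun p => by
    show c (p + (K * w₀) • e) = _; rw [map_add, hc, hce, mul_one]
  have hdv : ∀ p : Fin 2 → ℝ, d (p + v) = d p := fun p => by
    show d (p + (K * w₀) • e) = _; rw [map_add, hd, hde, mul_zero, add_zero]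
  refine ⟨L, v, ?_⟩
  rintro _ ⟨p, hp, rfl⟩
  have hpU : p ∈ U := hp
  obtain ⟨y, hyY, hΛy⟩ := hp.1
  rw [← hY] at hyY
  obtain ⟨x₀, ⟨hx₀S, hx₀face⟩, hρx₀⟩ := hyY
  have hx₀w : w x₀ = w₀ := hx₀face
  refine ⟨⟨x₀, hx₀S, ?_⟩, τ p, fun q hq hne => ?_⟩
  · show L x₀ = p + (K * w₀) • e
    rw [hL, hx₀w, hρx₀, hΛy]
  · obtain ⟨x, hxS, rfl⟩ := hq
    rw [hcL, hdL, hcv, hdv]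
    by_cases hface : w x = w₀
    · have hxY : ρ x ∈ Y := by rw [← hY]; exact ⟨x, ⟨hxS, hface⟩, rfl⟩
      have hq' : Λ (ρ x) ∈ Λ '' Y := ⟨ρ x, hxY, rfl⟩
      have hne' : Λ (ρ x) ≠ p := by
        intro h; apply hne
        show L x = p + (K * w₀) • e
        rw [hL, hface, h]
      have := hτ p hpU _ hq' hne'
      rw [hface]
      linarith
    · have h1 := hw1 x hxS hface
      have h2 := hBbound p hpU x hxS
      have h3 : K * w x + (B + 1) ≤ K * w₀ := by
        have : K * (w x + γ) ≤ K * w₀ := mul_le_mul_of_nonneg_left h1 hK0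
        linarith [mul_add K (w x) γ]
      linarith

/-- coordinate-face special case (T2): face functional `ψ ∈ {0} ∪ [1,∞)` on `S`, face `S ∩ {ψ = 0}`. -/
theorem um_lift {E F : Type*} [AddCommGroup E] [Module ℝ E] [AddCommGroup F] [Module ℝ F]
    (S : Set E) (hS : S.Finite) (ψ : E →ₗ[ℝ] ℝ) (hψS : ∀ x ∈ S, ψ x = 0 ∨ 1 ≤ ψ x)
    (ρ : E →ₗ[ℝ] F) (Y : Set F) (hY : ρ '' (S ∩ {x | ψ x = 0}) = Y)
    (Λ : F →ₗ[ℝ] (Fin 2 → ℝ)) (c d : (Fin 2 → ℝ) →+ ℝ)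
    (hc : ∀ (a : ℝ) (x : Fin 2 → ℝ), c (a • x) = a * c x) (hd : ∀ (a : ℝ) (x : Fin 2 → ℝ), d (a • x) = a * d x)
    (e : Fin 2 → ℝ) (hce : c e = 1) (hde : d e = 0) :
    ∃ (L : E →ₗ[ℝ] (Fin 2 → ℝ)) (v : Fin 2 → ℝ), (fun p => p + v) '' UM[c, d, Λ '' Y] ⊆ UM[c, d, L '' S] := by
  have hwS : ∀ x ∈ S, (-ψ) x = 0 ∨ (-ψ) x + 1 ≤ 0 := fun x hx => by
    rcases hψS x hx with h | h
    · left; simp [h]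
    · right; simp only [LinearMap.neg_apply]; linarith
  have hY' : ρ '' (S ∩ {x | (-ψ) x = 0}) = Y := by
    have : {x : E | (-ψ) x = 0} = {x | ψ x = 0} := by ext x; simp
    rw [this]; exact hY
  exact um_lift_face S hS (-ψ) 0 1 one_pos hwS ρ Y hY' Λ c d hc hd e hce hde

/-- corollary: the lifted shadow has at least as many uniquely maximised points as the face shadow's pencil count,
all of them vertices. -/
theorem ncard_um_le_shadow_lift {E F : Type*} [AddCommGroup E] [Module ℝ E] [AddCommGroup F] [Module ℝ F]
    (S : Set E) (hS : S.Finite) (ψ : E →ₗ[ℝ] ℝ) (hψS : ∀ x ∈ S, ψ x = 0 ∨ 1 ≤ ψ x)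
    (ρ : E →ₗ[ℝ] F) (Y : Set F) (hY : ρ '' (S ∩ {x | ψ x = 0}) = Y)
    (Λ : F →ₗ[ℝ] (Fin 2 → ℝ)) (c d : (Fin 2 → ℝ) →+ ℝ)
    (hc : ∀ (a : ℝ) (x : Fin 2 → ℝ), c (a • x) = a * c x) (hd : ∀ (a : ℝ) (x : Fin 2 → ℝ), d (a • x) = a * d x)
    (e : Fin 2 → ℝ) (hce : c e = 1) (hde : d e = 0) :
    ∃ L : E →ₗ[ℝ] (Fin 2 → ℝ),
      (UM[c, d, Λ '' Y]).ncard ≤ (Set.extremePoints ℝ (convexHull ℝ (L '' S))).ncard := by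
  obtain ⟨L, v, hL⟩ := um_lift S hS ψ hψS ρ Y hY Λ c d hc hd e hce hde
  refine ⟨L, ?_⟩
  rw [← Set.ncard_image_of_injective _ (add_left_injective v)]
  refine Set.ncard_le_ncard (hL.trans (um_subset_extremePoints _ c d hc hd)) ?_
  exact (hS.image L).subset extremePoints_convexHull_subset

/-- **face-lift count** (vertex currency): if the shadow `Λ(Y)` of the face image has more than `4·B` vertices, some
shadow of `S` has more than `B` vertices. -/
theorem shadow_faceLift_count {E F : Type*} [AddCommGroup E] [Module ℝ E] [AddCommGroup F] [Module ℝ F]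
    (S : Set E) (hS : S.Finite) (ψ : E →ₗ[ℝ] ℝ) (hψS : ∀ x ∈ S, ψ x = 0 ∨ 1 ≤ ψ x)
    (ρ : E →ₗ[ℝ] F) (Y : Set F) (hY : ρ '' (S ∩ {x | ψ x = 0}) = Y)
    (Λ : F →ₗ[ℝ] (Fin 2 → ℝ)) (B : ℕ)
    (hB : 4 * B < (Set.extremePoints ℝ (convexHull ℝ (Λ '' Y))).ncard) :
    ∃ L : E →ₗ[ℝ] (Fin 2 → ℝ), B < (Set.extremePoints ℝ (convexHull ℝ (L '' S))).ncard := by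
  have hYfin : Y.Finite := by rw [← hY]; exact (hS.subset Set.inter_subset_left).image _
  obtain ⟨c, d, e, hc, hd, hce, hde, hcount⟩ :=
    exists_pencil_of_many_vertices (Λ '' Y) (hYfin.image Λ) B hB
  obtain ⟨L, hL⟩ := ncard_um_le_shadow_lift S hS ψ hψS ρ Y hY Λ c d hc hd e hce hde
  exact ⟨L, lt_of_lt_of_le hcount hL⟩

/-- **face-lift count, valid-inequality version** (for G♭ ⇒ G): if the shadow `Λ(Y)` of the read-out of the face
`S ∩ {w = w₀}` (any inequality valid on the finite set `S`) has more than `4·B` vertices, some shadow of `S` has more than `B`. -/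
theorem shadow_faceLift_count_face {E F : Type*} [AddCommGroup E] [Module ℝ E] [AddCommGroup F] [Module ℝ F]
    (S : Set E) (hS : S.Finite) (w : E →ₗ[ℝ] ℝ) (w₀ : ℝ) (hvalid : ∀ x ∈ S, w x ≤ w₀)
    (ρ : E →ₗ[ℝ] F) (Y : Set F) (hY : ρ '' (S ∩ {x | w x = w₀}) = Y)
    (Λ : F →ₗ[ℝ] (Fin 2 → ℝ)) (B : ℕ)
    (hB : 4 * B < (Set.extremePoints ℝ (convexHull ℝ (Λ '' Y))).ncard) :
    ∃ L : E →ₗ[ℝ] (Fin 2 → ℝ), B < (Set.extremePoints ℝ (convexHull ℝ (L '' S))).ncard := by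
  have hYfin : Y.Finite := by rw [← hY]; exact (hS.subset Set.inter_subset_left).image _
  obtain ⟨c, d, e, hc, hd, hce, hde, hcount⟩ :=
    exists_pencil_of_many_vertices (Λ '' Y) (hYfin.image Λ) B hB
  obtain ⟨γ, hγ, hwS⟩ := exists_face_gap S hS w w₀ hvalid
  obtain ⟨L, v, hL⟩ := um_lift_face S hS w w₀ γ hγ hwS ρ Y hY Λ c d hc hd e hce hde
  refine ⟨L, lt_of_lt_of_le hcount ?_⟩
  rw [← Set.ncard_image_of_injective _ (add_left_injective v)]
  refine Set.ncard_le_ncard (hL.trans (um_subset_extremePoints _ c d hc hd)) ?_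
  exact (hS.image L).subset extremePoints_convexHull_subset

/-! ## HY21 Proposition 19: the `2^h` vertices of `COR(K_h)` are in convex position under the parabola map
`x ↦ (Σ_i 2^i x_ii, Σ_{i,j} 2^{i+j} x_ij)` (the vertex of `b` goes to `(N_b, N_b²)`, `N_b = Σ_i 2^i b_i`). -/

section Prop19

open Literature.Combinatorics.Optimization (corVec corPolytopeGraph)

/-- binary value of a bit vector -/
def binValN {h : ℕ} (b : Fin h → Bool) : ℕ := ∑ i, if b i then 2 ^ (i : ℕ) else 0

theorem binValN_succ {h : ℕ} (b : Fin (h + 1) → Bool) :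
    binValN b = (if b 0 then 1 else 0) + 2 * binValN (fun i : Fin h => b i.succ) := by
  unfold binValN
  rw [Fin.sum_univ_succ, Finset.mul_sum]
  have h1 : (if b 0 = true then 2 ^ ((0 : Fin (h + 1)) : ℕ) else 0) = if b 0 = true then 1 else 0 := by simp
  have h2 : ∀ i : Fin h, (if b i.succ = true then 2 ^ ((i.succ : Fin (h + 1)) : ℕ) else 0)
      = 2 * (if b i.succ = true then 2 ^ (i : ℕ) else 0) := by
    intro i; by_cases hb : b i.succ <;> simp [hb, Fin.val_succ, pow_succ, mul_comm]
  rw [h1]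
  exact congrArg _ (Finset.sum_congr rfl fun i _ => h2 i)

theorem binValN_injective : ∀ h : ℕ, Function.Injective (binValN (h := h))
  | 0 => fun b b' _ => funext fun i => i.elim0
  | h + 1 => by
      intro b b' heq
      rw [binValN_succ b, binValN_succ b'] at heq
      have h0 : b 0 = b' 0 := by
        have := congrArg (· % 2) heq
        cases hb : b 0 <;> cases hb' : b' 0 <;> simp [hb, hb'] at this ⊢
      have htail : binValN (fun i : Fin h => b i.succ) = binValN (fun i : Fin h => b' i.succ) := by
        rw [h0] at heq; omega
      have ih := binValN_injective h htail
      funext i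
      refine Fin.cases h0 (fun j => ?_) i
      exact congrFun ih j

/-- the parabola map of HY21 Prop 19 -/
noncomputable def parab (h : ℕ) : (Fin h × Fin h → ℝ) →ₗ[ℝ] (Fin 2 → ℝ) where
  toFun x := ![∑ i : Fin h, (2 : ℝ) ^ (i : ℕ) * x (i, i), ∑ p : Fin h × Fin h, (2 : ℝ) ^ ((p.1 : ℕ) + (p.2 : ℕ)) * x p]
  map_add' x y := by
    ext j; fin_cases j <;> simp [Finset.sum_add_distrib, mul_add]
  map_smul' a x := by
    ext j; fin_cases j <;> simp [Finset.mul_sum, mul_left_comm, smul_eq_mul]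

theorem corVec_top {h : ℕ} (b : Fin h → Bool) (p : Fin h × Fin h) :
    corVec (⊤ : SimpleGraph (Fin h)) b p = if (b p.1 && b p.2) = true then 1 else 0 := by
  unfold corVec
  by_cases hp : p.1 = p.2
  · rw [if_pos hp, hp, Bool.and_self]
  · rw [if_neg hp, if_pos ((SimpleGraph.top_adj _ _).2 hp)]

theorem parab_corVec {h : ℕ} (b : Fin h → Bool) :
    parab h (corVec (⊤ : SimpleGraph (Fin h)) b) = ![(binValN b : ℝ), (binValN b : ℝ) ^ 2] := by
  have hN : ((binValN b : ℕ) : ℝ) = ∑ i : Fin h, if b i then (2 : ℝ) ^ (i : ℕ) else 0 := by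
    unfold binValN; push_cast; simp
  have h0 : ∑ i : Fin h, (2 : ℝ) ^ (i : ℕ) * corVec (⊤ : SimpleGraph (Fin h)) b (i, i) =
      ∑ i : Fin h, if b i then (2 : ℝ) ^ (i : ℕ) else 0 := by
    refine Finset.sum_congr rfl fun i _ => ?_
    rw [corVec_top]; cases b i <;> simp
  have h1 : ∑ p : Fin h × Fin h, (2 : ℝ) ^ ((p.1 : ℕ) + (p.2 : ℕ)) * corVec (⊤ : SimpleGraph (Fin h)) b p =
      (∑ i : Fin h, if b i then (2 : ℝ) ^ (i : ℕ) else 0) * (∑ i : Fin h, if b i then (2 : ℝ) ^ (i : ℕ) else 0) := by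
    rw [Finset.sum_mul_sum, ← Finset.sum_product', Finset.univ_product_univ]
    refine Finset.sum_congr rfl fun p _ => ?_
    rw [corVec_top]; cases b p.1 <;> cases b p.2 <;> simp [pow_add]
  ext j; fin_cases j
  · simp [parab, h0, hN]
  · simp [parab, h1, hN, sq]

/-- **HY21 Prop 19**: the parabola shadow of `COR(K_h)` has exactly `2^h` vertices. -/
theorem clique_parabola_shadow (h : ℕ) :
    (Set.extremePoints ℝ (convexHull ℝ
      (parab h '' Set.range (corVec (⊤ : SimpleGraph (Fin h)))))).ncard = 2 ^ h := by
  classical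
  set X := parab h '' Set.range (corVec (⊤ : SimpleGraph (Fin h))) with hX
  let P : (Fin h → Bool) → (Fin 2 → ℝ) := fun b => ![(binValN b : ℝ), (binValN b : ℝ) ^ 2]
  have hXP : X = Set.range P := by
    ext q; constructor
    · rintro ⟨_, ⟨b, rfl⟩, rfl⟩; exact ⟨b, (parab_corVec b).symm⟩
    · rintro ⟨b, rfl⟩; exact ⟨_, ⟨b, rfl⟩, parab_corVec b⟩
  have hPinj : Function.Injective P := by
    intro b b' hbb
    have h0 := congrFun hbb 0
    simp only [P, Matrix.cons_val_zero] at h0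
    exact binValN_injective h (by exact_mod_cast h0)
  -- every point of `X` is a strict maximiser of `2 N_b x₀ − x₁`
  have hext : X ⊆ Set.extremePoints ℝ (convexHull ℝ X) := by
    rintro q ⟨_, ⟨b, rfl⟩, rfl⟩
    rw [parab_corVec]
    let g : (Fin 2 → ℝ) →ₗ[ℝ] ℝ := (2 * (binValN b : ℝ)) • LinearMap.proj 0 - LinearMap.proj 1
    refine mem_extremePoints_of_strict_max X g (hXP ▸ ⟨b, rfl⟩) fun q hq hne => ?_
    rw [hXP] at hq
    obtain ⟨b', rfl⟩ := hq
    have hNN : (binValN b' : ℝ) ≠ (binValN b : ℝ) := by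
      intro hN; apply hne
      show P b' = P b
      simp only [P, hN]
    have hpos : 0 < ((binValN b : ℝ) - binValN b') ^ 2 := by
      have := sub_ne_zero.2 hNN.symm
      positivity
    simp only [g, P, LinearMap.sub_apply, LinearMap.smul_apply, LinearMap.proj_apply, Matrix.cons_val_zero,
      Matrix.cons_val_one, smul_eq_mul, Matrix.cons_val_fin_one]
    nlinarith [hpos]
  have hEq : Set.extremePoints ℝ (convexHull ℝ X) = X :=
    Set.Subset.antisymm extremePoints_convexHull_subset hext
  rw [hEq, hXP, ← Set.image_univ, Set.ncard_image_of_injective _ hPinj, Set.ncard_univ, Nat.card_eq_fintype_card]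
  simp

end Prop19


end FaceLiftGeo

/-! ## G♭ ⇒ G (rev 5, PROVED): the AFHMS clique face + HY21 Prop 19 + ONE valid-inequality face lift. -/

/-- growth: `4 · 2^((log₂ t + c)^c) < 2^h` whenever `h ≥ c₀ t`, eventually in `t` (from c1's `growth_eventually`). -/
theorem four_T_lt_two_pow (c : ℕ) {c₀ : ℝ} (hc₀ : 0 < c₀) :
    ∃ t₁ : ℕ, ∀ t ≥ t₁, ∀ h : ℕ, c₀ * t ≤ h → 4 * T c t < 2 ^ h := by
  obtain ⟨r₀, _, hr₀⟩ := growth_eventually c (half_pos hc₀)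
  refine ⟨max r₀ (Nat.ceil (3 / c₀)), fun t ht h hh => ?_⟩
  have htr : r₀ ≤ t := le_of_max_le_left ht
  have htc : Nat.ceil (3 / c₀) ≤ t := le_of_max_le_right ht
  have h3 : 3 ≤ c₀ * t := by
    have h1 : 3 / c₀ ≤ (t : ℝ) := le_trans (Nat.le_ceil _) (by exact_mod_cast htc)
    have := mul_le_mul_of_nonneg_left h1 hc₀.le
    rwa [mul_div_cancel₀ _ hc₀.ne'] at this
  have hA := hr₀ t htr
  have hT : ((T c t : ℕ) : ℝ) = (2 : ℝ) ^ ((Nat.log 2 t + c) ^ c) := by push_cast; rfl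
  have h4pos : (0 : ℝ) ≤ 4 * (t : ℝ) ^ 4 := by positivity
  have hA' : (2 : ℝ) ^ ((Nat.log 2 t + c) ^ c) < (2 : ℝ) ^ (c₀ / 2 * ((t / 2 : ℕ) : ℝ)) := by linarith
  have hexp1 : c₀ / 2 * ((t / 2 : ℕ) : ℝ) ≤ c₀ * t / 4 := by
    have : ((t / 2 : ℕ) : ℝ) ≤ (t : ℝ) / 2 := Nat.cast_div_le
    nlinarith
  have hexp2 : (2 : ℝ) + c₀ * t / 4 ≤ c₀ * t := by linarith
  have hB : (4 : ℝ) * (2 : ℝ) ^ (c₀ / 2 * ((t / 2 : ℕ) : ℝ)) ≤ (2 : ℝ) ^ (h : ℝ) := by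
    have e4 : (4 : ℝ) = (2 : ℝ) ^ (2 : ℝ) := by norm_num
    rw [e4, ← Real.rpow_add two_pos]
    exact Real.rpow_le_rpow_of_exponent_le one_le_two (by linarith)
  have hfin : ((4 * T c t : ℕ) : ℝ) < ((2 ^ h : ℕ) : ℝ) := by
    push_cast
    rw [← Real.rpow_natCast 2 h]
    calc (4 : ℝ) * 2 ^ ((Nat.log 2 t + c) ^ c) < 4 * (2 : ℝ) ^ (c₀ / 2 * ((t / 2 : ℕ) : ℝ)) := by linarith
      _ ≤ (2 : ℝ) ^ (h : ℝ) := hB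
  exact_mod_cast hfin

/-- the summed functional `x ↦ Σ_i cvᵢ ⬝ x` of finitely many inequalities -/
def sumDot {ι : Type} [Fintype ι] {k : ℕ} (cv : Fin k → (ι → ℝ)) : (ι → ℝ) →ₗ[ℝ] ℝ where
  toFun x := ∑ i, cv i ⬝ᵥ x
  map_add' x y := by simp [dotProduct_add, Finset.sum_add_distrib]
  map_smul' a x := by simp [dotProduct_smul, Finset.mul_sum, smul_eq_mul]

theorem sumDot_apply {ι : Type} [Fintype ι] {k : ℕ} (cv : Fin k → (ι → ℝ)) (x : ι → ℝ) :
    sumDot cv x = ∑ i, cv i ⬝ᵥ x := rfl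

/-- **G♭ ⇒ G** (kernel-checked): from the AFHMS clique face, the parabola shadow of `COR(K_h)` (`2^h` vertices,
`clique_parabola_shadow`) pulls back along `π` to a shadow of the face's vertex read-out, and `um_lift_face` realises a
quarter of its uniquely-maximised points as vertices of a shadow of the vertex set of `COR(G_{t,t})`; `4·2^((log₂ t+c)^c)
< 2^h` for `h ≥ c₀ t` eventually. -/
theorem gridCorShadowHard_of_cliqueFace (hF : GridCorCliqueFace) : GridCorShadowHard := by
  classical
  intro c
  obtain ⟨c₀, hc₀, t₀, hF⟩ := hF
  obtain ⟨t₁, ht₁⟩ := four_T_lt_two_pow c hc₀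
  refine ⟨max t₀ t₁, fun t ht => ?_⟩
  obtain ⟨h, hh, k, cv, δ, π, hvalid, hface⟩ := hF t (le_of_max_le_left ht)
  set S : Set (Fin (t * t) × Fin (t * t) → ℝ) := Set.range (corVec (gridGraph t)) with hSdef
  have hP : corPolytopeGraph (gridGraph t) = convexHull ℝ S := rfl
  have hSfin : S.Finite := Set.finite_range _
  -- the summed valid inequality `w x ≤ w₀` and its face
  let w : (Fin (t * t) × Fin (t * t) → ℝ) →ₗ[ℝ] ℝ := sumDot cv
  let w₀ : ℝ := ∑ i, δ i
  have hvalidP : ∀ x ∈ convexHull ℝ S, w x ≤ w₀ := fun x hx => by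
    rw [show w x = ∑ i, cv i ⬝ᵥ x from rfl]
    exact Finset.sum_le_sum fun i _ => hvalid i x (hP ▸ hx)
  have hvalidS : ∀ x ∈ S, w x ≤ w₀ := fun x hx => hvalidP x (subset_convexHull ℝ S hx)
  have htight : ∀ x ∈ convexHull ℝ S, ((∀ i, cv i ⬝ᵥ x = δ i) ↔ w x = w₀) := by
    intro x hx
    rw [show w x = ∑ i, cv i ⬝ᵥ x from rfl]
    constructor
    · intro hall; exact Finset.sum_congr rfl fun i _ => hall i
    · intro hsum i
      have := (Finset.sum_eq_sum_iff_of_le (fun i _ => hvalid i x (hP ▸ hx))).1 hsum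
      exact this i (Finset.mem_univ i)
  -- the face read-out `Y` and its hull `= COR(K_h)`
  set Y : Set (Fin h × Fin h → ℝ) := π '' (S ∩ {x | w x = w₀}) with hYdef
  have hconvY : convexHull ℝ Y = corPolytopeGraph (⊤ : SimpleGraph (Fin h)) := by
    rw [← hface, hP]
    have hE : convexHull ℝ S ∩ {x | ∀ i, cv i ⬝ᵥ x = δ i} = convexHull ℝ S ∩ {x | w x = w₀} := by
      ext x; constructor
      · rintro ⟨hx, hall⟩; exact ⟨hx, (htight x hx).1 hall⟩
      · rintro ⟨hx, hw⟩; exact ⟨hx, (htight x hx).2 hw⟩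
    rw [hE, convexHull_inter_face S w w₀ hvalidS, LinearMap.image_convexHull]
  -- the parabola shadow of `Y` has `2^h` vertices
  have hcount : (Set.extremePoints ℝ (convexHull ℝ (parab h '' Y))).ncard = 2 ^ h := by
    have : convexHull ℝ (parab h '' Y) =
        convexHull ℝ (parab h '' Set.range (corVec (⊤ : SimpleGraph (Fin h)))) := by
      rw [← LinearMap.image_convexHull, hconvY, corPolytopeGraph, LinearMap.image_convexHull]
    rw [this]; exact clique_parabola_shadow h
  have hB : 4 * T c t < (Set.extremePoints ℝ (convexHull ℝ (parab h '' Y))).ncard := by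
    rw [hcount]; exact ht₁ t (le_of_max_le_right ht) h hh
  obtain ⟨L, hL⟩ := shadow_faceLift_count_face S hSfin w w₀ hvalidS π Y rfl (parab h) (T c t) hB
  exact ⟨L, hL⟩

/-- exponent bookkeeping for the face lift: `log₂ n ≤ 2 log₂ r + 7` ⇒ `(log₂ n + c)^c + 2 ≤ (log₂ r + (3c+8))^(3c+8)`. -/
theorem faceLift_threshold (c a b : ℕ) (h : a ≤ 2 * b + 7) :
    (a + c) ^ c + 2 ≤ (b + (3 * c + 8)) ^ (3 * c + 8) := by
  set y := b + c + 7 with hy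
  have hy2 : 2 ≤ y := by omega
  have h1 : (a + c) ^ c ≤ y ^ c * y ^ c := by
    calc (a + c) ^ c ≤ (2 * y) ^ c := Nat.pow_le_pow_left (by omega) c
      _ = 2 ^ c * y ^ c := Nat.mul_pow 2 y c
      _ ≤ y ^ c * y ^ c := Nat.mul_le_mul_right _ (Nat.pow_le_pow_left hy2 c)
  have hP : 1 ≤ y ^ c * y ^ c := Nat.one_le_iff_ne_zero.2 (by positivity)
  have h2 : y ^ c * y ^ c + 2 ≤ y ^ (2 * c + 2) := by
    have : y ^ (2 * c + 2) = y ^ c * y ^ c * (y * y) := by ring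
    rw [this]
    generalize hPdef : y ^ c * y ^ c = P at *
    have hyy : 4 ≤ y * y := Nat.mul_le_mul hy2 hy2
    have h4 : P * 4 ≤ P * (y * y) := Nat.mul_le_mul_left P hyy
    omega
  have h3 : y ^ (2 * c + 2) ≤ (b + (3 * c + 8)) ^ (2 * c + 2) := Nat.pow_le_pow_left (by omega) _
  have h4 : (b + (3 * c + 8)) ^ (2 * c + 2) ≤ (b + (3 * c + 8)) ^ (3 * c + 8) :=
    Nat.pow_le_pow_right (by omega) (by omega)
  omega

/-- integrality of support points: coordinates of `realOf d` lie in `{0} ∪ [1, ∞)`. -/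
theorem suppPts_coord_dichotomy {σ : Type} (g : MvPolynomial σ ℝ≥0) :
    ∀ x ∈ suppPts g, ∀ i, x i = 0 ∨ 1 ≤ x i := by
  rintro x ⟨d, _, rfl⟩ i
  rcases Nat.eq_zero_or_pos (d i) with h | h
  · left; simp [realOf, h]
  · right
    show (1 : ℝ) ≤ ((d i : ℕ) : ℝ)
    exact_mod_cast h

/-- the coordinate face functional `ψ_Z x = Σ_{e∈Z} x_e` on a point set with coordinates in `{0} ∪ [1,∞)`:
`ψ_Z ∈ {0} ∪ [1,∞)` on `S`, and `S ∩ {ψ_Z = 0}` is the coordinate face `S ∩ {x_e = 0, e ∈ Z}`. -/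
theorem sumCoord_face {α : Type} [Fintype α] [DecidableEq α] (S : Set (α → ℝ))
    (hint : ∀ x ∈ S, ∀ i, x i = 0 ∨ 1 ≤ x i) (Z : Finset α) :
    (∀ x ∈ S, (∑ a ∈ Z, LinearMap.proj a : (α → ℝ) →ₗ[ℝ] ℝ) x = 0 ∨
        1 ≤ (∑ a ∈ Z, LinearMap.proj a : (α → ℝ) →ₗ[ℝ] ℝ) x) ∧
      S ∩ {x | (∑ a ∈ Z, LinearMap.proj a : (α → ℝ) →ₗ[ℝ] ℝ) x = 0} = S ∩ {x | ∀ e ∈ Z, x e = 0} := by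
  have hψ : ∀ x : α → ℝ, (∑ a ∈ Z, LinearMap.proj a : (α → ℝ) →ₗ[ℝ] ℝ) x = ∑ a ∈ Z, x a := fun x => by
    simp [LinearMap.sum_apply]
  have hnn : ∀ x ∈ S, ∀ i, 0 ≤ x i := fun x hx i => by
    rcases hint x hx i with h | h
    · rw [h]
    · linarith
  have hzero : ∀ x ∈ S, ((∑ a ∈ Z, LinearMap.proj a : (α → ℝ) →ₗ[ℝ] ℝ) x = 0 ↔ ∀ e ∈ Z, x e = 0) := by
    intro x hx
    rw [hψ]
    exact Finset.sum_eq_zero_iff_of_nonneg fun e _ => hnn x hx e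
  refine ⟨fun x hx => ?_, ?_⟩
  · by_cases hall : ∀ e ∈ Z, x e = 0
    · exact Or.inl ((hzero x hx).2 hall)
    · right
      push Not at hall
      obtain ⟨a, haZ, hxa⟩ := hall
      have h1 : 1 ≤ x a := by
        rcases hint x hx a with h | h
        · exact absurd h hxa
        · exact h
      rw [hψ]
      exact le_trans h1 (Finset.single_le_sum (fun b _ => hnn x hx b) haZ)
  · ext x
    simp only [Set.mem_inter_iff, Set.mem_setOf_eq]
    constructor
    · rintro ⟨hx, h0⟩; exact ⟨hx, (hzero x hx).1 h0⟩
    · rintro ⟨hx, h0⟩; exact ⟨hx, (hzero x hx).2 h0⟩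

/-- **T2, PROVED (rev 4)** — the face lift `QueueGridZeroOnePoints → PPShadowHard → NFPShadowHard`:
with `r + 1 = ⌊⌊√n⌋/2⌋` (so `(r+1)(2r+1) ≤ n` and `log₂ n ≤ 2 log₂ r + 5`), a PP shadow with `> 2^((log₂ r + 3c+8)^(3c+8))
≥ 4·2^((log₂ n + c)^c)` vertices has a coordinate pencil uniquely maximised at `> 2^((log₂ n + c)^c)` points, and `um_lift`
along A1's located face realises them all as vertices of a shadow of `NFP_n`. -/
theorem faceLift (hA : QueueGridZeroOnePoints) (hP : PPShadowHard) : NFPShadowHard := by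
  classical
  intro c
  obtain ⟨r₀, hr₀⟩ := hP (3 * c + 8)
  refine ⟨4 * (max (r₀ + 1) 3) ^ 2, fun n hn => ?_⟩
  set M := max (r₀ + 1) 3 with hM
  have hM3 : 3 ≤ M := le_max_right _ _
  have hMr : r₀ + 1 ≤ M := le_max_left _ _
  set s := Nat.sqrt n with hs
  have hsM : 2 * M ≤ s := by
    rw [hs, Nat.le_sqrt]
    nlinarith [hn]
  set r := s / 2 - 1 with hr
  have hr2 : 2 ≤ r := by omega
  have hr1 : 1 ≤ r := by omega
  have hrr₀ : r₀ ≤ r := by omega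
  have hr_s : r + 1 = s / 2 := by omega
  have hss : s * s ≤ n := Nat.sqrt_le n
  have hface : (r + 1) * (2 * r + 1) ≤ n := by
    have h2 : 2 * (s / 2) ≤ s := Nat.mul_div_le s 2
    calc (r + 1) * (2 * r + 1) ≤ (r + 1) * (2 * (r + 1)) := Nat.mul_le_mul_left _ (by omega)
      _ = (s / 2) * (2 * (s / 2)) := by rw [hr_s]
      _ ≤ (s / 2) * s := Nat.mul_le_mul_left _ h2
      _ ≤ s * s := Nat.mul_le_mul_right _ (Nat.div_le_self s 2)
      _ ≤ n := hss
  obtain ⟨Z, f, hZf⟩ := hA r n hr1 hface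
  obtain ⟨Λ, hΛ⟩ := hr₀ r hrr₀
  -- `log₂ n ≤ 2 log₂ r + 5`
  have hlogn : Nat.log 2 n < 2 * Nat.log 2 r + 6 := by
    have hA2 : r < 2 ^ (Nat.log 2 r + 1) := Nat.lt_pow_succ_log_self (by norm_num) r
    have hn_lt : n < (s + 1) * (s + 1) := Nat.lt_succ_sqrt n
    have hs4 : s + 1 ≤ 4 * r := by omega
    have h16 : n < 16 * (r * r) := by
      calc n < (s + 1) * (s + 1) := hn_lt
        _ ≤ (4 * r) * (4 * r) := Nat.mul_le_mul hs4 hs4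
        _ = 16 * (r * r) := by ring
    have hrr : r * r < 2 ^ (Nat.log 2 r + 1) * 2 ^ (Nat.log 2 r + 1) := Nat.mul_self_lt_mul_self hA2
    have hpow : n < 2 ^ (2 * Nat.log 2 r + 6) := by
      calc n < 16 * (r * r) := h16
        _ < 16 * (2 ^ (Nat.log 2 r + 1) * 2 ^ (Nat.log 2 r + 1)) := Nat.mul_lt_mul_of_pos_left hrr (by norm_num)
        _ = 2 ^ (2 * Nat.log 2 r + 6) := by ring
    have hn0 : n ≠ 0 := by
      have h6 : 6 ≤ s := by omega
      have h36 : 36 ≤ s * s := Nat.mul_le_mul h6 h6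
      omega
    exact Nat.log_lt_of_lt_pow hn0 hpow
  -- threshold: `4 · T c n ≤ T (3c+8) r < #vertices of the PP shadow`
  have hthr : 4 * T c n ≤ T (3 * c + 8) r := by
    have h := faceLift_threshold c (Nat.log 2 n) (Nat.log 2 r) (by omega)
    show 4 * 2 ^ ((Nat.log 2 n + c) ^ c) ≤ 2 ^ ((Nat.log 2 r + (3 * c + 8)) ^ (3 * c + 8))
    calc 4 * 2 ^ ((Nat.log 2 n + c) ^ c) = 2 ^ ((Nat.log 2 n + c) ^ c + 2) := by rw [pow_add]; ring
      _ ≤ 2 ^ ((Nat.log 2 r + (3 * c + 8)) ^ (3 * c + 8)) := Nat.pow_le_pow_right (by norm_num) h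
  have hΛ' : 4 * T c n < (Set.extremePoints ℝ (convexHull ℝ (Λ '' Set.range (patternVec r)))).ncard :=
    lt_of_le_of_lt hthr hΛ
  -- the lift along A1's located coordinate face
  have hSfin : (suppPts (nestFreeMatchingPoly n ℝ≥0)).Finite := (Finset.finite_toSet _).image _
  obtain ⟨hψS, hset⟩ := sumCoord_face (suppPts (nestFreeMatchingPoly n ℝ≥0)) (suppPts_coord_dichotomy _) Z
  have hY : (LinearMap.funLeft ℝ ℝ f) ''
      (suppPts (nestFreeMatchingPoly n ℝ≥0) ∩
        {x | (∑ a ∈ Z, LinearMap.proj a : ((Fin (2 * n) × Fin (2 * n)) → ℝ) →ₗ[ℝ] ℝ) x = 0}) =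
      Set.range (patternVec r) := by
    rw [hset]; exact hZf
  exact shadow_faceLift_count (suppPts (nestFreeMatchingPoly n ℝ≥0)) hSfin _ hψS (LinearMap.funLeft ℝ ℝ f)
    (Set.range (patternVec r)) hY Λ (T c n) hΛ'

/-! ## S — the PORT of HY21 Thm 42 + balancing to `NN_n` (rev 2: PROVED, was `stub_split`)

The pencil calculus of `Theorems/DivisionGapShadowCofactorSplitFormula.lean` (`sh_eval_le`, `sh_le_sh_mul`,
`finite_pts`) and `ncard_extremePoints_le_of_separating_pencils` (`…ShadowDegreeSplitPencil.lean`) are generic in the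
polynomial; the only Birkhoff-specific input there (`support_perPoly`) is replaced by the DEFINITION of `suppPts`. -/

section Port

local notation3 (prettyPrint := false) "PT[" φ ", " f "]" =>
  (⇑φ) '' ((MvPolynomial.support f : Finset _) : Set _)

local notation3 (prettyPrint := false) "SH[" φ ", " c ", " d ", " f "]" =>
  Set.ncard {p | p ∈ PT[φ, f] ∧ ∃ t : ℝ, ∀ q ∈ PT[φ, f], q ≠ p → c q + t * d q < c p + t * d p}

/-- **HY21 Thm 42 for the tree's formula model, NN instance** (port of
`DivisionGap.ShadowCofactorSplit.ncard_extremePoints_le_of_multiple`): if `h' ≠ 0` then every planar shadow of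
`NFP_n = conv(suppPts NN_n)` has at most `4(3·E₊(NN_n·h') + 1)` vertices, `E₊ = formulaComplexity` over `ℝ≥0`.
[cite: HrubesYehudayoff2021, Thm. 42 (= Thm. 1 with Lemma 12)] -/
theorem nn_ncard_extremePoints_le_of_multiple {n : ℕ}
    (L : ((Fin (2 * n) × Fin (2 * n)) → ℝ) →ₗ[ℝ] (Fin 2 → ℝ))
    (h' : MvPolynomial (Fin (2 * n) × Fin (2 * n)) ℝ≥0) (hh' : h' ≠ 0) :
    (Set.extremePoints ℝ (convexHull ℝ (L '' suppPts (nestFreeMatchingPoly n ℝ≥0)))).ncard ≤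
      4 * (3 * formulaComplexity (nestFreeMatchingPoly n ℝ≥0 * h') + 1) := by
  classical
  let φ : ((Fin (2 * n) × Fin (2 * n)) →₀ ℕ) →+ (Fin 2 → ℝ) :=
    { toFun := fun m => L (realOf m)
      map_zero' := by
        show L (realOf (0 : (Fin (2 * n) × Fin (2 * n)) →₀ ℕ)) = 0
        have h0 : realOf (0 : (Fin (2 * n) × Fin (2 * n)) →₀ ℕ) = 0 := by
          funext ij
          simp [realOf]
        rw [h0, map_zero]
      map_add' := by
        intro a b
        show L (realOf (a + b)) = L (realOf a) + L (realOf b)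
        rw [← map_add]
        congr 1
        funext ij
        simp [realOf, Nat.cast_add] }
  have hφ : ∀ m, φ m = L (realOf m) := fun _ => rfl
  have hPT : PT[φ, nestFreeMatchingPoly n ℝ≥0] = L '' suppPts (nestFreeMatchingPoly n ℝ≥0) := by
    change (fun m => L (realOf m)) '' _ = _
    rw [suppPts, Set.image_image]
  obtain ⟨P, hF, hfan, hcomp, hsize⟩ :=
    ArithCircuit.exists_computes_size_eq_formulaComplexity (nestFreeMatchingPoly n ℝ≥0 * h')
  have hfin : (L '' suppPts (nestFreeMatchingPoly n ℝ≥0)).Finite := by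
    rw [← hPT]
    exact finite_pts φ _
  refine ncard_extremePoints_le_of_separating_pencils _ hfin _ fun c d hsep => ?_
  rw [← hPT]
  calc SH[φ, c, d, nestFreeMatchingPoly n ℝ≥0]
      ≤ SH[φ, c, d, nestFreeMatchingPoly n ℝ≥0 * h'] := sh_le_sh_mul φ c d _ _ hh' hsep
    _ = SH[φ, c, d, P.eval] := by rw [show P.eval = nestFreeMatchingPoly n ℝ≥0 * h' from hcomp]
    _ ≤ 3 * P.size + 1 := sh_eval_le φ c d P hF hfan
    _ = 3 * formulaComplexity (nestFreeMatchingPoly n ℝ≥0 * h') + 1 := by rw [hsize]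

end Port

/-- exponent bookkeeping for S: `18 E² + 4 ≤ (ℓ + c₃)^{c₃}` with `E = (ℓ + k')^{k'} + 2ℓ + 5`, from the tree's
`exists_exponent 0 k'` at `ℓ + 1`. -/
theorem exists_exponent_nn (k' : ℕ) : ∃ c₃ : ℕ, ∀ ℓ : ℕ,
    18 * ((ℓ + k') ^ k' + 2 * ℓ + 5) ^ 2 + 4 ≤ (ℓ + c₃) ^ c₃ := by
  obtain ⟨c₂, hc₂⟩ := exists_exponent 0 k'
  refine ⟨c₂ + 1, fun ℓ => ?_⟩
  have h1 := hc₂ (ℓ + 1)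
  have hmono : (ℓ + k') ^ k' + 2 * ℓ + 5 ≤ (ℓ + 1 + (ℓ + 1 + 0) ^ 0 + k') ^ k' + 2 * (ℓ + 1) + 3 := by
    have : (ℓ + k') ^ k' ≤ (ℓ + 1 + (ℓ + 1 + 0) ^ 0 + k') ^ k' :=
      Nat.pow_le_pow_left (by simp only [add_zero, pow_zero]; omega) k'
    omega
  have h2 : 18 * ((ℓ + k') ^ k' + 2 * ℓ + 5) ^ 2 + 4 ≤
      18 * ((ℓ + 1 + (ℓ + 1 + 0) ^ 0 + k') ^ k' + 2 * (ℓ + 1) + 3) ^ 2 + 4 :=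
    Nat.add_le_add_right (Nat.mul_le_mul_left 18 (Nat.pow_le_pow_left hmono 2)) 4
  have h3 : (ℓ + 1 + c₂) ^ c₂ ≤ (ℓ + (c₂ + 1)) ^ (c₂ + 1) :=
    calc (ℓ + 1 + c₂) ^ c₂ = (ℓ + (c₂ + 1)) ^ c₂ := by rw [show ℓ + 1 + c₂ = ℓ + (c₂ + 1) by omega]
      _ ≤ (ℓ + (c₂ + 1)) ^ (c₂ + 1) := Nat.pow_le_pow_right (by omega) (by omega)
  exact h2.trans (h1.trans h3)

/-- **S, PROVED — the shadow hypothesis N1 gives THE RUNG R2** (NN twin of the kernel-checked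
`DivisionGap.shadowCofactorSplit_proof`, without degree reduction): if R2 fails at `(k, c)` then for the large `n` and
`h ≠ 0` witnessing it, `deg(NN_n·h) ≤ n + 2^{(ℓ+k')^{k'}}`, `#vars = 4n²`, `L₊ ≤ 2^{(ℓ+c)^c}` (`k' = k + c + 1`), so
`formulaComplexity_le_two_pow` gives a monotone formula of size `2^{18E²}`, `E = (ℓ+k')^{k'} + 2ℓ + 5`, and by
`nn_ncard_extremePoints_le_of_multiple` EVERY shadow of `NFP_n` has `≤ 2^{18E²+4} ≤ 2^{(ℓ+c₃)^{c₃}}` vertices —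
contradicting N1 at `c₃`. [cite: HrubesYehudayoff2021 Thm 42; BurgisserClausenShokrollahi1997 (21.35)/(21.36)] -/
theorem rung_of_shadow (hS : NFPShadowHard) : NNQuasiPolyLogDegreeCofactorHard := by
  intro k c
  set k' := k + c + 1 with hk'
  obtain ⟨c₃, hc₃⟩ := exists_exponent_nn k'
  obtain ⟨n₀, hn₀⟩ := hS c₃
  refine ⟨n₀, fun n hn h hh hdeg => ?_⟩
  by_contra hs
  push Not at hs
  obtain ⟨L, hL⟩ := hn₀ n hn
  set ℓ := Nat.log 2 n with hℓ
  set B := (ℓ + k') ^ k' with hB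
  have hk1 : 1 ≤ ℓ + k' := by omega
  have hkB : (ℓ + k) ^ k ≤ B := by
    rcases Nat.eq_zero_or_pos k with hk0 | hkpos
    · subst hk0; rw [pow_zero]; exact Nat.one_le_pow _ _ hk1
    · exact (Nat.pow_le_pow_left (by omega) k).trans (Nat.pow_le_pow_right hk1 (by omega))
  have hcB : (ℓ + c) ^ c ≤ B := by
    rcases Nat.eq_zero_or_pos c with hc0 | hcpos
    · rw [hc0, pow_zero]; exact Nat.one_le_pow _ _ hk1
    · exact (Nat.pow_le_pow_left (by omega) c).trans (Nat.pow_le_pow_right hk1 (by omega))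
  set E := B + 2 * ℓ + 5 with hE
  have h2E : 2 ^ E = 2 ^ B * 2 ^ (ℓ + 1) * 2 ^ (ℓ + 1) * 8 := by
    rw [hE, show B + 2 * ℓ + 5 = B + (ℓ + 1) + (ℓ + 1) + 3 by omega, pow_add, pow_add, pow_add]
    norm_num
  have hnlt : n < 2 ^ (ℓ + 1) := Nat.lt_pow_succ_log_self Nat.one_lt_two n
  have ha1 : 1 ≤ 2 ^ B := Nat.one_le_two_pow
  have hb1 : 1 ≤ 2 ^ (ℓ + 1) := Nat.one_le_two_pow
  have hprod : 2 ^ (ℓ + 1) * 2 ^ (ℓ + 1) ≤ 2 ^ B * 2 ^ (ℓ + 1) * 2 ^ (ℓ + 1) := by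
    calc 2 ^ (ℓ + 1) * 2 ^ (ℓ + 1) = 1 * 2 ^ (ℓ + 1) * 2 ^ (ℓ + 1) := by ring
      _ ≤ 2 ^ B * 2 ^ (ℓ + 1) * 2 ^ (ℓ + 1) := Nat.mul_le_mul_right _ (Nat.mul_le_mul_right _ ha1)
  have hsq : 2 ^ (ℓ + 1) ≤ 2 ^ (ℓ + 1) * 2 ^ (ℓ + 1) := Nat.le_mul_of_pos_right _ (by omega)
  have hBle : 2 ^ B ≤ 2 ^ B * 2 ^ (ℓ + 1) * 2 ^ (ℓ + 1) := by
    calc 2 ^ B = 2 ^ B * 1 * 1 := by ring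
      _ ≤ 2 ^ B * 2 ^ (ℓ + 1) * 2 ^ (ℓ + 1) := Nat.mul_le_mul (Nat.mul_le_mul_left _ hb1) hb1
  have hd : n + 2 ^ B < 2 ^ E := by rw [h2E]; omega
  have hcard : Fintype.card (Fin (2 * n) × Fin (2 * n)) ≤ 2 ^ E := by
    rw [Fintype.card_prod, Fintype.card_fin, h2E]
    calc 2 * n * (2 * n) = 4 * (n * n) := by ring
      _ ≤ 4 * (2 ^ (ℓ + 1) * 2 ^ (ℓ + 1)) := Nat.mul_le_mul_left 4 (Nat.mul_le_mul hnlt.le hnlt.le)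
      _ ≤ 4 * (2 ^ B * 2 ^ (ℓ + 1) * 2 ^ (ℓ + 1)) := Nat.mul_le_mul_left 4 hprod
      _ ≤ 2 ^ B * 2 ^ (ℓ + 1) * 2 ^ (ℓ + 1) * 8 := by omega
  have hNN : (nestFreeMatchingPoly n ℝ≥0).totalDegree ≤ n := by
    simpa using (nestFreeMatchingPoly_isHomogeneous (n := n) (k := ℝ≥0)).totalDegree_le
  have hdeg' : (nestFreeMatchingPoly n ℝ≥0 * h).totalDegree ≤ n + 2 ^ B :=
    calc (nestFreeMatchingPoly n ℝ≥0 * h).totalDegree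
        ≤ (nestFreeMatchingPoly n ℝ≥0).totalDegree + h.totalDegree := totalDegree_mul _ _
      _ ≤ n + 2 ^ ((ℓ + k) ^ k) := add_le_add hNN hdeg
      _ ≤ n + 2 ^ B := Nat.add_le_add_left (Nat.pow_le_pow_right Nat.two_pos hkB) n
  have hL' : complexity (nestFreeMatchingPoly n ℝ≥0 * h) ≤ 2 ^ E :=
    hs.trans ((Nat.pow_le_pow_right Nat.two_pos hcB).trans
      ((Nat.pow_le_pow_right Nat.two_pos (by omega : B ≤ E))))
  have hE1 : 1 ≤ E := by omega
  have hfc := formulaComplexity_le_two_pow hdeg' hd hcard hL' hE1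
  have hV := nn_ncard_extremePoints_le_of_multiple L h hh
  have hexp : 18 * E ^ 2 + 4 ≤ (ℓ + c₃) ^ c₃ := hc₃ ℓ
  have hfinal : (Set.extremePoints ℝ (convexHull ℝ (L '' suppPts (nestFreeMatchingPoly n ℝ≥0)))).ncard ≤
      T c₃ n :=
    calc (Set.extremePoints ℝ (convexHull ℝ (L '' suppPts (nestFreeMatchingPoly n ℝ≥0)))).ncard
        ≤ 4 * (3 * formulaComplexity (nestFreeMatchingPoly n ℝ≥0 * h) + 1) := hV
      _ ≤ 4 * (3 * 2 ^ (18 * E ^ 2) + 1) :=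
          Nat.mul_le_mul_left 4 (Nat.add_le_add_right (Nat.mul_le_mul_left 3 hfc) 1)
      _ ≤ 2 ^ (18 * E ^ 2 + 4) := by
          rw [pow_add]
          have h16 : (2 : ℕ) ^ 4 = 16 := by norm_num
          rw [h16]
          have := Nat.one_le_two_pow (n := 18 * E ^ 2)
          omega
      _ ≤ 2 ^ ((ℓ + c₃) ^ c₃) := Nat.pow_le_pow_right Nat.two_pos hexp
  exact absurd hL (not_lt.2 hfinal)

/-! ## G♭ constructor toolkit (rev 6; offered to the G♭ = stmt-27045 lead, p10 g2 / qg1 g0 — NOT a claim on that item).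
AFHMS [arXiv:1806.00541] Thm 6 builds its bound in THREE «face cut out by valid inequalities, then a linear map» steps:
(i) `H ≼ G_{t,t}` (Obs 5: deletion = projection, contraction of `uv` = face `x_u = x_v = y_{uv}`), (ii) the gadget face of
`COR(H)` projects onto `COR(K_{h,h})` — the complete BIPARTITE graph (p.6 L21–22: "projecting onto the diagonal dotted
edges … projects to COR(K_{h,h})"), (iii) "since `K_h` is a minor of `K_{h,h}`" (p.6 L24).  FORM A (`GridCorCliqueFace`)
asks for ONE family valid on `COR(G_{t,t})` and ONE linear `π` onto `COR(K_h)`, so the constructor must FLATTEN the chain: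
`faceProj_compose` (generic: two steps ⇒ one, by the finite-gap trick of `exists_face_gap`) and
`corBiclique_faceProj_corClique` (step (iii) done outright in FORM-A currency: the perfect-matching contraction face of
`COR(K_{h,h})` read out onto `COR(K_h)`).  What remains for 27045 is (i)+(ii) as ONE explicit face/π statement ending in
`corPolytopeGraph (completeBipartiteGraph (Fin h) (Fin h))`, then two applications of `faceProj_compose`. -/

section FaceChain

open Literature.Combinatorics.Optimization (corVec_apply_diag corVec_apply_adj)

/-- validity on a finite generating set passes to its hull -/
theorem dot_le_of_mem_convexHull {ι : Type} [Fintype ι] (S : Set (ι → ℝ)) (u : ι → ℝ) (δ : ℝ)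
    (h : ∀ x ∈ S, u ⬝ᵥ x ≤ δ) : ∀ x ∈ convexHull ℝ S, u ⬝ᵥ x ≤ δ := by
  have hconv : Convex ℝ {x : ι → ℝ | u ⬝ᵥ x ≤ δ} :=
    convex_halfSpace_le ⟨fun x y => dotProduct_add u x y, fun c x => by
      rw [dotProduct_smul, smul_eq_mul]⟩ δ
  exact fun x hx => (convexHull_min (fun x hx => (h x hx : x ∈ {x : ι → ℝ | u ⬝ᵥ x ≤ δ})) hconv) hx

/-- the vector representing `x ↦ v ⬝ π x` -/
theorem exists_pullback_vec {ι ι' : Type} [Fintype ι] [DecidableEq ι] [Fintype ι']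
    (π : (ι → ℝ) →ₗ[ℝ] (ι' → ℝ)) (v : ι' → ℝ) : ∃ u : ι → ℝ, ∀ x, u ⬝ᵥ x = v ⬝ᵥ π x := by
  refine ⟨v ᵥ* LinearMap.toMatrix' π, fun x => ?_⟩
  rw [← dotProduct_mulVec, LinearMap.toMatrix'_mulVec]

/-- the vector representing `x ↦ Σ_i cv i ⬝ x` -/
theorem sum_dotProduct_vec {ι : Type} [Fintype ι] {k : ℕ} (cv : Fin k → (ι → ℝ)) (x : ι → ℝ) :
    (∑ i, cv i) ⬝ᵥ x = ∑ i, cv i ⬝ᵥ x := by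
  simp [sum_dotProduct]

/-- **Face–projection steps compose.**  Step 1: inequalities `cv₁ i ⬝ x ≤ δ₁ i` valid on `conv S` (`S` finite) and a
linear `π₁` taking the face onto `conv S'`; step 2: inequalities `cv₂ j ⬝ y ≤ δ₂ j` valid on `conv S'` and a linear `π₂`
taking that face onto `Q`.  Then ONE family valid on `conv S` and ONE linear map take a face of `conv S` onto `Q`
(the pulled-back step-2 inequalities are made valid on all of `conv S` by adding a large multiple of the summed step-1
inequality — the finite gap off the step-1 face, `exists_face_gap`). -/
theorem faceProj_compose {ι ι' ι'' : Type} [Fintype ι] [DecidableEq ι] [Fintype ι'] [Fintype ι'']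
    (S : Set (ι → ℝ)) (hS : S.Finite)
    {k₁ : ℕ} (cv₁ : Fin k₁ → (ι → ℝ)) (δ₁ : Fin k₁ → ℝ) (π₁ : (ι → ℝ) →ₗ[ℝ] (ι' → ℝ))
    (hv₁ : ∀ i, ∀ x ∈ convexHull ℝ S, cv₁ i ⬝ᵥ x ≤ δ₁ i)
    (S' : Set (ι' → ℝ))
    (h₁ : π₁ '' (convexHull ℝ S ∩ {x | ∀ i, cv₁ i ⬝ᵥ x = δ₁ i}) = convexHull ℝ S')
    {k₂ : ℕ} (cv₂ : Fin k₂ → (ι' → ℝ)) (δ₂ : Fin k₂ → ℝ) (π₂ : (ι' → ℝ) →ₗ[ℝ] (ι'' → ℝ))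
    (hv₂ : ∀ j, ∀ y ∈ convexHull ℝ S', cv₂ j ⬝ᵥ y ≤ δ₂ j)
    (Q : Set (ι'' → ℝ))
    (h₂ : π₂ '' (convexHull ℝ S' ∩ {y | ∀ j, cv₂ j ⬝ᵥ y = δ₂ j}) = Q) :
    ∃ (k : ℕ) (cv : Fin k → (ι → ℝ)) (δ : Fin k → ℝ) (π : (ι → ℝ) →ₗ[ℝ] (ι'' → ℝ)),
      (∀ i, ∀ x ∈ convexHull ℝ S, cv i ⬝ᵥ x ≤ δ i) ∧
      π '' (convexHull ℝ S ∩ {x | ∀ i, cv i ⬝ᵥ x = δ i}) = Q := by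
  classical
  -- the summed step-1 inequality `w ⬝ x ≤ w₀`, tight exactly on the step-1 face
  let w : ι → ℝ := ∑ i, cv₁ i
  let w₀ : ℝ := ∑ i, δ₁ i
  have hw : ∀ x, w ⬝ᵥ x = ∑ i, cv₁ i ⬝ᵥ x := fun x => sum_dotProduct_vec cv₁ x
  have hwvalid : ∀ x ∈ convexHull ℝ S, w ⬝ᵥ x ≤ w₀ := fun x hx => by
    rw [hw]; exact Finset.sum_le_sum fun i _ => hv₁ i x hx
  have htight : ∀ x ∈ convexHull ℝ S, ((∀ i, cv₁ i ⬝ᵥ x = δ₁ i) ↔ w ⬝ᵥ x = w₀) := by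
    intro x hx; rw [hw]; constructor
    · intro h; exact Finset.sum_congr rfl fun i _ => h i
    · intro h i; exact (Finset.sum_eq_sum_iff_of_le fun i _ => hv₁ i x hx).1 h i (Finset.mem_univ i)
  -- gap off the face on the finite set `S`
  let wL : (ι → ℝ) →ₗ[ℝ] ℝ :=
    { toFun := fun x => w ⬝ᵥ x, map_add' := fun x y => dotProduct_add w x y,
      map_smul' := fun a x => by rw [dotProduct_smul]; rfl }
  obtain ⟨γ, hγ, hgap⟩ := exists_face_gap S hS wL w₀ fun x hx => hwvalid x (subset_convexHull ℝ S hx)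
  have hgap' : ∀ x ∈ S, ¬ w ⬝ᵥ x = w₀ → w ⬝ᵥ x + γ ≤ w₀ := fun x hx hne =>
    ((hgap x hx).resolve_left hne)
  -- pulled-back step-2 functionals
  choose u hu using fun j => exists_pullback_vec π₁ (cv₂ j)
  let B : ℝ := ∑ j, ∑ x ∈ hS.toFinset, |u j ⬝ᵥ x - δ₂ j|
  have hB : ∀ j, ∀ x ∈ S, u j ⬝ᵥ x - δ₂ j ≤ B := by
    intro j x hx
    have h1 : |u j ⬝ᵥ x - δ₂ j| ≤ ∑ x ∈ hS.toFinset, |u j ⬝ᵥ x - δ₂ j| :=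
      Finset.single_le_sum (f := fun x => |u j ⬝ᵥ x - δ₂ j|) (fun _ _ => abs_nonneg _) (hS.mem_toFinset.2 hx)
    have h2 : ∑ x ∈ hS.toFinset, |u j ⬝ᵥ x - δ₂ j| ≤ B :=
      Finset.single_le_sum (f := fun j => ∑ x ∈ hS.toFinset, |u j ⬝ᵥ x - δ₂ j|)
        (fun _ _ => Finset.sum_nonneg fun _ _ => abs_nonneg _) (Finset.mem_univ j)
    linarith [le_abs_self (u j ⬝ᵥ x - δ₂ j)]
  have hB0 : 0 ≤ B := Finset.sum_nonneg fun _ _ => Finset.sum_nonneg fun _ _ => abs_nonneg _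
  let M : ℝ := B / γ
  have hM0 : 0 ≤ M := div_nonneg hB0 hγ.le
  have hMγ : M * γ = B := div_mul_cancel₀ _ hγ.ne'
  -- the combined family, indexed by `Fin (k₁ + k₂)`
  let cvB : Fin k₂ → (ι → ℝ) := fun j => u j + M • w
  let δB : Fin k₂ → ℝ := fun j => δ₂ j + M * w₀
  have hcvB : ∀ j x, cvB j ⬝ᵥ x = u j ⬝ᵥ x + M * (w ⬝ᵥ x) := fun j x => by
    simp only [cvB, add_dotProduct, smul_dotProduct, smul_eq_mul]
  let cv : Fin (k₁ + k₂) → (ι → ℝ) := fun i => Sum.elim cv₁ cvB (finSumFinEquiv.symm i)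
  let δ : Fin (k₁ + k₂) → ℝ := fun i => Sum.elim δ₁ δB (finSumFinEquiv.symm i)
  have hcv_inl : ∀ i, cv (finSumFinEquiv (Sum.inl i)) = cv₁ i := fun i => by
    simp only [cv, Equiv.symm_apply_apply, Sum.elim_inl]
  have hcv_inr : ∀ j, cv (finSumFinEquiv (Sum.inr j)) = cvB j := fun j => by
    simp only [cv, Equiv.symm_apply_apply, Sum.elim_inr]
  have hδ_inl : ∀ i, δ (finSumFinEquiv (Sum.inl i)) = δ₁ i := fun i => by
    simp only [δ, Equiv.symm_apply_apply, Sum.elim_inl]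
  have hδ_inr : ∀ j, δ (finSumFinEquiv (Sum.inr j)) = δB j := fun j => by
    simp only [δ, Equiv.symm_apply_apply, Sum.elim_inr]
  have hall : ∀ (P : Fin (k₁ + k₂) → Prop),
      (∀ i, P i) ↔ (∀ i, P (finSumFinEquiv (Sum.inl i))) ∧ ∀ j, P (finSumFinEquiv (Sum.inr j)) := by
    intro P; constructor
    · intro h; exact ⟨fun i => h _, fun j => h _⟩
    · rintro ⟨h1, h2⟩ i
      obtain ⟨s, rfl⟩ := finSumFinEquiv.surjective i
      cases s with
      | inl i => exact h1 i
      | inr j => exact h2 j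
  -- validity of the pulled-back inequalities on `S`, hence on `conv S`
  have hvalidB : ∀ j, ∀ x ∈ convexHull ℝ S, cvB j ⬝ᵥ x ≤ δB j := by
    intro j
    apply dot_le_of_mem_convexHull
    intro x hx
    rw [hcvB]
    by_cases hface : w ⬝ᵥ x = w₀
    · -- on the step-1 face: `π₁ x ∈ conv S'`, where step 2 is valid
      have hxF : x ∈ convexHull ℝ S ∩ {x | ∀ i, cv₁ i ⬝ᵥ x = δ₁ i} :=
        ⟨subset_convexHull ℝ S hx, (htight x (subset_convexHull ℝ S hx)).2 hface⟩
      have hπx : π₁ x ∈ convexHull ℝ S' := h₁ ▸ ⟨x, hxF, rfl⟩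
      have := hv₂ j (π₁ x) hπx
      rw [← hu] at this
      rw [hface]
      show u j ⬝ᵥ x + M * w₀ ≤ δ₂ j + M * w₀
      linarith
    · have h1 := hgap' x hx hface
      have h2 := hB j x hx
      have h3 : M * (w ⬝ᵥ x) + B ≤ M * w₀ := by
        have := mul_le_mul_of_nonneg_left h1 hM0
        rw [mul_add, hMγ] at this; exact this
      show u j ⬝ᵥ x + M * (w ⬝ᵥ x) ≤ δ₂ j + M * w₀
      linarith
  refine ⟨k₁ + k₂, cv, δ, π₂ ∘ₗ π₁, ?_, ?_⟩
  · rw [hall]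
    refine ⟨fun i => ?_, fun j => ?_⟩
    · rw [hcv_inl, hδ_inl]; exact hv₁ i
    · rw [hcv_inr, hδ_inr]; exact hvalidB j
  · -- the combined face is `F₁ ∩ π₁⁻¹ F₂`
    have hface : convexHull ℝ S ∩ {x | ∀ i, cv i ⬝ᵥ x = δ i} =
        (convexHull ℝ S ∩ {x | ∀ i, cv₁ i ⬝ᵥ x = δ₁ i}) ∩ π₁ ⁻¹' {y | ∀ j, cv₂ j ⬝ᵥ y = δ₂ j} := by
      ext x
      simp only [Set.mem_inter_iff, Set.mem_setOf_eq, Set.mem_preimage]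
      constructor
      · rintro ⟨hx, h⟩
        rw [hall (fun i => cv i ⬝ᵥ x = δ i)] at h
        obtain ⟨hA, hBt⟩ := h
        have hA' : ∀ i, cv₁ i ⬝ᵥ x = δ₁ i := fun i => by
          have := hA i; rwa [hcv_inl, hδ_inl] at this
        have hwx : w ⬝ᵥ x = w₀ := (htight x hx).1 hA'
        refine ⟨⟨hx, hA'⟩, fun j => ?_⟩
        have := hBt j
        rw [hcv_inr, hδ_inr, hcvB, hwx] at this
        have h' : u j ⬝ᵥ x = δ₂ j := by
          have : u j ⬝ᵥ x + M * w₀ = δ₂ j + M * w₀ := this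
          linarith
        rwa [hu] at h'
      · rintro ⟨⟨hx, hA'⟩, hBt⟩
        refine ⟨hx, ?_⟩
        rw [hall (fun i => cv i ⬝ᵥ x = δ i)]
        refine ⟨fun i => ?_, fun j => ?_⟩
        · rw [hcv_inl, hδ_inl]; exact hA' i
        · rw [hcv_inr, hδ_inr, hcvB, (htight x hx).1 hA', hu, hBt j]
    rw [hface, LinearMap.coe_comp, Set.image_comp, Set.image_inter_preimage, h₁, h₂]

open Classical in
/-- **`K_h ≼ K_{h,h}` in face–projection form** (the last link of AFHMS Thm 6, p.6 L24: "since `K_h` is a minor of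
`K_{h,h}`"): the face `{x_{uᵢ} = y_{uᵢvᵢ} = x_{vᵢ} : i < h}` of `COR(K_{h,h})` (valid: `y_{uv} ≤ x_u`, `y_{uv} ≤ x_v`;
it contracts the perfect matching `uᵢvᵢ`) is mapped by the coordinate read-out `π x (i,j) = x_{(uᵢ,uᵢ)}` (`i = j`),
`x_{(uᵢ,vⱼ)}` (`i ≠ j`) EXACTLY onto `COR(K_h)`. -/
theorem corBiclique_faceProj_corClique (h : ℕ) :
    ∃ (k : ℕ) (cv : Fin k → ((Fin h ⊕ Fin h) × (Fin h ⊕ Fin h) → ℝ)) (δ : Fin k → ℝ)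
      (π : ((Fin h ⊕ Fin h) × (Fin h ⊕ Fin h) → ℝ) →ₗ[ℝ] (Fin h × Fin h → ℝ)),
      (∀ i, ∀ x ∈ corPolytopeGraph (completeBipartiteGraph (Fin h) (Fin h)), cv i ⬝ᵥ x ≤ δ i) ∧
      π '' (corPolytopeGraph (completeBipartiteGraph (Fin h) (Fin h)) ∩ {x | ∀ i, cv i ⬝ᵥ x = δ i})
        = corPolytopeGraph (⊤ : SimpleGraph (Fin h)) := by
  classical
  set K := completeBipartiteGraph (Fin h) (Fin h) with hK
  have hadj : ∀ i j : Fin h, K.Adj (Sum.inl i) (Sum.inr j) := fun i j => by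
    simp [hK, completeBipartiteGraph_adj]
  -- the `2h` contraction inequalities, `δ = 0`
  let cL : Fin h → ((Fin h ⊕ Fin h) × (Fin h ⊕ Fin h) → ℝ) := fun i =>
    Pi.single (Sum.inl i, Sum.inr i) 1 - Pi.single (Sum.inl i, Sum.inl i) 1
  let cR : Fin h → ((Fin h ⊕ Fin h) × (Fin h ⊕ Fin h) → ℝ) := fun i =>
    Pi.single (Sum.inl i, Sum.inr i) 1 - Pi.single (Sum.inr i, Sum.inr i) 1
  have hcL : ∀ i x, cL i ⬝ᵥ x = x (Sum.inl i, Sum.inr i) - x (Sum.inl i, Sum.inl i) := fun i x => by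
    simp only [cL, sub_dotProduct, single_dotProduct, one_mul]
  have hcR : ∀ i x, cR i ⬝ᵥ x = x (Sum.inl i, Sum.inr i) - x (Sum.inr i, Sum.inr i) := fun i x => by
    simp only [cR, sub_dotProduct, single_dotProduct, one_mul]
  let cv : Fin (h + h) → ((Fin h ⊕ Fin h) × (Fin h ⊕ Fin h) → ℝ) := fun t => Sum.elim cL cR (finSumFinEquiv.symm t)
  have hall : ∀ (P : Fin (h + h) → Prop),
      (∀ t, P t) ↔ (∀ i, P (finSumFinEquiv (Sum.inl i))) ∧ ∀ i, P (finSumFinEquiv (Sum.inr i)) := by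
    intro P; constructor
    · intro hP; exact ⟨fun i => hP _, fun i => hP _⟩
    · rintro ⟨h1, h2⟩ t
      obtain ⟨s, rfl⟩ := finSumFinEquiv.surjective t
      cases s with
      | inl i => exact h1 i
      | inr i => exact h2 i
  have hcv_inl : ∀ i, cv (finSumFinEquiv (Sum.inl i)) = cL i := fun i => by
    simp only [cv, Equiv.symm_apply_apply, Sum.elim_inl]
  have hcv_inr : ∀ i, cv (finSumFinEquiv (Sum.inr i)) = cR i := fun i => by
    simp only [cv, Equiv.symm_apply_apply, Sum.elim_inr]
  -- values on the generators
  have hdiag : ∀ (b : Fin h ⊕ Fin h → Bool) (v : Fin h ⊕ Fin h), corVec K b (v, v) = if b v then 1 else 0 :=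
    fun b v => corVec_apply_diag K b v
  have hedge : ∀ (b : Fin h ⊕ Fin h → Bool) (i j : Fin h),
      corVec K b (Sum.inl i, Sum.inr j) = if (b (Sum.inl i) && b (Sum.inr j)) then 1 else 0 :=
    fun b i j => corVec_apply_adj K b (hadj i j)
  have hvalL : ∀ i b, cL i ⬝ᵥ corVec K b ≤ 0 := fun i b => by
    rw [hcL, hedge, hdiag]; cases b (Sum.inl i) <;> cases b (Sum.inr i) <;> simp
  have hvalR : ∀ i b, cR i ⬝ᵥ corVec K b ≤ 0 := fun i b => by
    rw [hcR, hedge, hdiag]; cases b (Sum.inl i) <;> cases b (Sum.inr i) <;> simp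
  have htightv : ∀ b, (∀ t, cv t ⬝ᵥ corVec K b = 0) ↔ ∀ i, b (Sum.inl i) = b (Sum.inr i) := by
    intro b
    rw [hall (fun t => cv t ⬝ᵥ corVec K b = 0)]
    simp only [hcv_inl, hcv_inr, hcL, hcR, hedge, hdiag]
    constructor
    · rintro ⟨h1, h2⟩ i
      have a := h1 i; have c := h2 i
      cases hb : b (Sum.inl i) <;> cases hb' : b (Sum.inr i) <;> simp [hb, hb'] at a c ⊢
    · intro hb
      refine ⟨fun i => ?_, fun i => ?_⟩ <;> rw [hb i] <;> cases b (Sum.inr i) <;> simp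
  -- validity on `COR(K_{h,h}) = conv (range corVec)`
  set S : Set ((Fin h ⊕ Fin h) × (Fin h ⊕ Fin h) → ℝ) := Set.range (corVec K) with hS
  have hP : corPolytopeGraph K = convexHull ℝ S := rfl
  have hvalid : ∀ t, ∀ x ∈ convexHull ℝ S, cv t ⬝ᵥ x ≤ 0 := by
    rw [hall]
    refine ⟨fun i => dot_le_of_mem_convexHull S _ 0 ?_, fun i => dot_le_of_mem_convexHull S _ 0 ?_⟩
    · rintro _ ⟨b, rfl⟩; rw [hcv_inl]; exact hvalL i b
    · rintro _ ⟨b, rfl⟩; rw [hcv_inr]; exact hvalR i b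
  -- the read-out (a coordinate map)
  let e : Fin h × Fin h → (Fin h ⊕ Fin h) × (Fin h ⊕ Fin h) := fun p =>
    if p.1 = p.2 then (Sum.inl p.1, Sum.inl p.1) else (Sum.inl p.1, Sum.inr p.2)
  let π : ((Fin h ⊕ Fin h) × (Fin h ⊕ Fin h) → ℝ) →ₗ[ℝ] (Fin h × Fin h → ℝ) :=
    { toFun := fun x p => x (e p)
      map_add' := fun x y => rfl
      map_smul' := fun a x => rfl }
  have hπ : ∀ b, (∀ i, b (Sum.inl i) = b (Sum.inr i)) →
      π (corVec K b) = corVec (⊤ : SimpleGraph (Fin h)) (fun i => b (Sum.inl i)) := by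
    intro b hb
    funext p
    show corVec K b (e p) = _
    by_cases hp : p.1 = p.2
    · have he : e p = (Sum.inl p.1, Sum.inl p.1) := if_pos hp
      rw [he, hdiag]
      have : p = (p.1, p.1) := by ext <;> simp [hp]
      rw [this, corVec_apply_diag]
    · have he : e p = (Sum.inl p.1, Sum.inr p.2) := if_neg hp
      have key := corVec_apply_adj (⊤ : SimpleGraph (Fin h)) (fun i => b (Sum.inl i))
        ((SimpleGraph.top_adj p.1 p.2).2 hp)
      rw [Prod.mk.eta] at key
      rw [he, hedge, ← hb p.2, key]
  refine ⟨h + h, cv, fun _ => 0, π, fun t x hx => hvalid t x (hP ▸ hx), ?_⟩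
  -- face of the hull = hull of the tight generators; then push through `π`
  let wL : ((Fin h ⊕ Fin h) × (Fin h ⊕ Fin h) → ℝ) →ₗ[ℝ] ℝ :=
    { toFun := fun x => (∑ t, cv t) ⬝ᵥ x, map_add' := fun x y => dotProduct_add _ x y,
      map_smul' := fun a x => by rw [dotProduct_smul]; rfl }
  have hwL : ∀ x, wL x = ∑ t, cv t ⬝ᵥ x := fun x => sum_dotProduct_vec cv x
  have hwvalid : ∀ x ∈ S, wL x ≤ 0 := fun x hx => by
    rw [hwL]
    have := Finset.sum_le_sum fun t (_ : t ∈ Finset.univ) => hvalid t x (subset_convexHull ℝ S hx)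
    simpa using this
  have htight : ∀ x ∈ convexHull ℝ S, ((∀ t, cv t ⬝ᵥ x = 0) ↔ wL x = 0) := by
    intro x hx; rw [hwL]; constructor
    · intro hz; exact Finset.sum_eq_zero fun t _ => hz t
    · intro hz t
      have := (Finset.sum_eq_sum_iff_of_le fun t (_ : t ∈ Finset.univ) => hvalid t x hx).1 (by simpa using hz)
      exact this t (Finset.mem_univ t)
  have hE : convexHull ℝ S ∩ {x | ∀ t, cv t ⬝ᵥ x = 0} = convexHull ℝ S ∩ {x | wL x = 0} := by
    ext x; constructor
    · rintro ⟨hx, hz⟩; exact ⟨hx, (htight x hx).1 hz⟩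
    · rintro ⟨hx, hz⟩; exact ⟨hx, (htight x hx).2 hz⟩
  have htightS : S ∩ {x | wL x = 0} = (corVec K) '' {b | ∀ i, b (Sum.inl i) = b (Sum.inr i)} := by
    ext x; constructor
    · rintro ⟨⟨b, rfl⟩, hz⟩
      refine ⟨b, (htightv b).1 ((htight _ (subset_convexHull ℝ S ⟨b, rfl⟩)).2 hz), rfl⟩
    · rintro ⟨b, hb, rfl⟩
      exact ⟨⟨b, rfl⟩, (htight _ (subset_convexHull ℝ S ⟨b, rfl⟩)).1 ((htightv b).2 hb)⟩
  have himg : π '' ((corVec K) '' {b | ∀ i, b (Sum.inl i) = b (Sum.inr i)}) =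
      Set.range (corVec (⊤ : SimpleGraph (Fin h))) := by
    ext z; constructor
    · rintro ⟨_, ⟨b, hb, rfl⟩, rfl⟩; exact ⟨fun i => b (Sum.inl i), (hπ b hb).symm⟩
    · rintro ⟨a, rfl⟩
      refine ⟨corVec K (Sum.elim a a), ⟨Sum.elim a a, fun i => rfl, rfl⟩, ?_⟩
      rw [hπ (Sum.elim a a) fun i => rfl]; rfl
  rw [hP, hE, convexHull_inter_face S wL 0 hwvalid, LinearMap.image_convexHull, htightS, himg]
  rfl

end FaceChain

/-! ## Compositions (kernel-checked) -/

/-- N1 from the K1 heart A1 and the grid crux G. -/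
theorem nfpShadowHard_of (hA : QueueGridZeroOnePoints) (hG : GridCorShadowHard) : NFPShadowHard :=
  faceLift hA (ppShadow_of_grid hG)

/-- **THE RUNG from A1 + G** (modulo the two transfer stubs T1/T2; the port S is proved). -/
theorem rung_of (hA : QueueGridZeroOnePoints) (hG : GridCorShadowHard) : NNQuasiPolyLogDegreeCofactorHard :=
  rung_of_shadow (nfpShadowHard_of hA hG)

/-- the residual picture: A1 + G + degree reduction N2 ⇒ all multiples hard ⇒ `NNDivisionHard` (21181). -/
theorem nnDivisionHard_of (hA : QueueGridZeroOnePoints) (hG : GridCorShadowHard)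
    (hD : NNCofactorDegreeReduction) : NNDivisionHardLit :=
  nnDivisionHard_of_multiples (multiples_of_rung_of_reduction (rung_of hA hG) hD)

/-- A1 → G♭ → R2, kernel-checked apart from the two named inputs -/
theorem rung_of_flat (hA : QueueGridZeroOnePoints) (hF : GridCorCliqueFace) : NNQuasiPolyLogDegreeCofactorHard :=
  rung_of hA (gridCorShadowHard_of_cliqueFace hF)

/-- A1 → G♭ → P5 → 21181 (`NNDivisionHard`) -/
theorem nnDivisionHard_of_flat (hA : QueueGridZeroOnePoints) (hF : GridCorCliqueFace)
    (hD : NNCofactorDegreeReduction) : NNDivisionHardLit :=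
  nnDivisionHard_of hA (gridCorShadowHard_of_cliqueFace hF) hD

/-- A1 + G♭ ⇒ R2ᵒ (ORDER form of the rung; rev 7). -/
theorem orderRung_of_flat (hA : QueueGridZeroOnePoints) (hF : GridCorCliqueFace) : NNQuasiPolyLogOrderCofactorHard :=
  orderRung_of_rung (rung_of_flat hA hF)

/-- A1 + G♭ + the SHARPENED residual N2♯ ⇒ `NNDivisionHard` (rev 7). -/
theorem nnDivisionHard_of_flat_order (hA : QueueGridZeroOnePoints) (hF : GridCorCliqueFace)
    (hD : NNCofactorOrderReduction) : NNDivisionHardLit :=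
  nnDivisionHard_of_multiples (multiples_of_orderRung_of_orderReduction (orderRung_of_flat hA hF) hD)

/-- from the two former stubs, both theorems now (A1 since rev 8, G♭ = 27045 since rev 9) -/
theorem rung_of_stubs : NNQuasiPolyLogDegreeCofactorHard :=
  rung_of_flat stub_zeroOnePoints stub_cliqueFace

/-! ## rev 8: everything from item 27045 ALONE (A1 discharged) -/

/-- **27045 ⇒ R2** — the rung `NNQuasiPolyLogDegreeCofactorHard` (= tenure's R2 item text, `Iff.rfl`) from the route item
`GridCorCliqueFace` ALONE; the closer of record becomes `… := ShadowDivision.rung_of_27045 gridCorCliqueFace_holds`. -/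
theorem rung_of_27045 (hF : Summit.ValiantsHypothesis.ValiantsHypothesis.Theses.FifoMatching.GridCorCliqueFace) :
    NNQuasiPolyLogDegreeCofactorHard :=
  rung_of_flat queueGridZeroOnePoints_holds hF

/-- **27045 ⇒ R2ᵒ** (order form). -/
theorem orderRung_of_27045 (hF : Summit.ValiantsHypothesis.ValiantsHypothesis.Theses.FifoMatching.GridCorCliqueFace) :
    NNQuasiPolyLogOrderCofactorHard :=
  orderRung_of_flat queueGridZeroOnePoints_holds hF

/-- **27045 ⇒ N1** `NFPShadowHard` (quasi-polynomially many shadow vertices of `NFP_n`). -/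
theorem nfpShadowHard_of_27045 (hF : Summit.ValiantsHypothesis.ValiantsHypothesis.Theses.FifoMatching.GridCorCliqueFace) :
    NFPShadowHard :=
  nfpShadowHard_of queueGridZeroOnePoints_holds (gridCorShadowHard_of_cliqueFace hF)

/-- **27045 → N2♯ → 21181**, BY NAME: after this line the route's residual item `NNDivisionHard` needs exactly the grid
clique face (in print, being typed) and the law-side order reduction N2♯. -/
theorem route_21181_of_27045_order
    (hF : Summit.ValiantsHypothesis.ValiantsHypothesis.Theses.FifoMatching.GridCorCliqueFace)
    (hD : NNCofactorOrderReduction) :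
    Summit.ValiantsHypothesis.ValiantsHypothesis.Theses.FifoMatching.NNDivisionHard :=
  nnDivisionHard_of_flat_order queueGridZeroOnePoints_holds hF hD

/-- unconditional today: the PP-shadow statement already gives N1 (A1 discharged, T2 proved). -/
theorem nfpShadowHard_of_ppShadowHard (hP : PPShadowHard) : NFPShadowHard :=
  faceLift queueGridZeroOnePoints_holds hP

/-! ### by-name audits against the route file `Theses/FifoMatching.lean` rev 10 (the `…Lit` twins ARE the route decls;
G♭ is the route item stmt-ValiantsHypothesis-27045 itself) -/

example : NNDivisionHardLit ↔ Summit.ValiantsHypothesis.ValiantsHypothesis.Theses.FifoMatching.NNDivisionHard := Iff.rfl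
example : NNLinearDegreeCofactorHardLit ↔
    Summit.ValiantsHypothesis.ValiantsHypothesis.Theses.FifoMatching.NNLinearDegreeCofactorHard := Iff.rfl

/-- the rung implies the CLOSED item 23918 by name (sanity: R2 sits above 23918 on the ladder) -/
theorem route_23918_of_rung (hR : NNQuasiPolyLogDegreeCofactorHard) :
    Summit.ValiantsHypothesis.ValiantsHypothesis.Theses.FifoMatching.NNLinearDegreeCofactorHard :=
  linearDegree_of_rung hR

/-- **G♭ (27045, by name) ⇒ G** -/
theorem route_gridCorShadowHard_of_27045
    (hF : Summit.ValiantsHypothesis.ValiantsHypothesis.Theses.FifoMatching.GridCorCliqueFace) : GridCorShadowHard :=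
  gridCorShadowHard_of_cliqueFace hF

/-- A1 → G♭ (27045) → N2 → the route's residual item 21181 `NNDivisionHard`, all BY NAME -/
theorem route_21181_of_flat (hA : QueueGridZeroOnePoints)
    (hF : Summit.ValiantsHypothesis.ValiantsHypothesis.Theses.FifoMatching.GridCorCliqueFace)
    (hD : NNCofactorDegreeReduction) :
    Summit.ValiantsHypothesis.ValiantsHypothesis.Theses.FifoMatching.NNDivisionHard :=
  nnDivisionHard_of_flat hA hF hD

/-- by name, rev 7: A1 → 27045 → N2♯ → stmt-21181 (the residual of 21181 after this line is N2♯, not N2). -/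
theorem route_21181_of_flat_order (hA : QueueGridZeroOnePoints)
    (hF : Summit.ValiantsHypothesis.ValiantsHypothesis.Theses.FifoMatching.GridCorCliqueFace)
    (hD : NNCofactorOrderReduction) :
    Summit.ValiantsHypothesis.ValiantsHypothesis.Theses.FifoMatching.NNDivisionHard :=
  nnDivisionHard_of_flat_order hA hF hD

/-! ### audit -/
#print axioms multiples_of_rung_of_reduction
#print axioms rung_of_shadow
#print axioms ppShadow_of_grid
#print axioms um_lift
#print axioms shadow_faceLift_count
#print axioms faceLift
#print axioms clique_parabola_shadow
#print axioms gridCorShadowHard_of_cliqueFace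
#print axioms rung_of_flat
#print axioms route_gridCorShadowHard_of_27045
#print axioms route_21181_of_flat
#print axioms orderRung_of_rung
#print axioms constantTerm_cofactor_hard
#print axioms orderReduction_of_reduction
#print axioms route_21181_of_flat_order
#print axioms nfpShadowHard_of
#print axioms linearDegree_of_rung
#print axioms rung_of_stubs
#print axioms queueGridZeroOnePoints_holds
#print axioms rung_of_27045
#print axioms route_21181_of_27045_order
#print axioms faceProj_compose
#print axioms corBiclique_faceProj_corClique

end


/-! ## rev 9: the line is SORRY-FREE — every conclusion outright (27045 is a theorem)

Nothing below is a ledger closing (those are the Theorems ports F5–F8 of val-port-2 g1 / val-port-4 g1, R198 (c)); it is the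
kernel-checked certificate that the line `shadow_division` delivers, from theorems in the tree ALONE: the R2 rung (item
stmt-27271's text, `Iff.rfl`), its ORDER form R2ᵒ, `NFPShadowHard`, and the reduction of the crux `NNDivisionHard`
(stmt-21181) to the single law-side residual N2♯ `NNCofactorOrderReduction`. -/

/-- ★ **R2 HOLDS** (= the text of item stmt-ValiantsHypothesis-27271 `Theses.FifoMatching.NNQuasiPolyLogDegreeCofactorHard`):
`NN_n · h` is quasi-polynomially hard over `ℝ≥0` for every nonzero cofactor of quasi-polynomial degree. -/
theorem rung_holds : NNQuasiPolyLogDegreeCofactorHard :=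
  rung_of_27045 Literature.Combinatorics.Optimization.AboulkerEtAl2019_gridCorCliqueFace

/-- ★ **R2ᵒ HOLDS** (ORDER form: every nonzero cofactor with SOME nonzero homogeneous component of quasi-polynomial degree). -/
theorem orderRung_holds : NNQuasiPolyLogOrderCofactorHard :=
  orderRung_of_27045 Literature.Combinatorics.Optimization.AboulkerEtAl2019_gridCorCliqueFace

/-- ★ `NFPShadowHard` HOLDS: the nest-free perfect matching polytope has 2-D shadows with super-quasi-polynomially many vertices. -/
theorem nfpShadowHard_holds : NFPShadowHard :=
  nfpShadowHard_of_27045 Literature.Combinatorics.Optimization.AboulkerEtAl2019_gridCorCliqueFace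

/-- ★ **THE CRUX REDUCES TO THE RESIDUAL ALONE**: N2♯ `NNCofactorOrderReduction` ⇒ route crux stmt-ValiantsHypothesis-21181
`Theses.FifoMatching.NNDivisionHard`, kernel-checked from theorems in the tree (honest label: N2♯ is law-side and OPEN; HY21
Thm 30 blocks the shadow method for it; VP ≠ VNP is NOT proved). -/
theorem route_21181_of_orderReduction (hD : NNCofactorOrderReduction) :
    Summit.ValiantsHypothesis.ValiantsHypothesis.Theses.FifoMatching.NNDivisionHard :=
  route_21181_of_27045_order Literature.Combinatorics.Optimization.AboulkerEtAl2019_gridCorCliqueFace hD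

/-- the degree-form residual N2 also suffices (weaker statement of the same reduction). -/
theorem route_21181_of_degreeReduction (hD : NNCofactorDegreeReduction) :
    Summit.ValiantsHypothesis.ValiantsHypothesis.Theses.FifoMatching.NNDivisionHard :=
  route_21181_of_orderReduction (orderReduction_of_reduction hD)

#print axioms stub_cliqueFace
#print axioms rung_holds
#print axioms orderRung_holds
#print axioms route_21181_of_orderReduction

/-! ### by-name audit against `Theses/FifoMatching.lean` rev 11: the R2 item stmt-ValiantsHypothesis-27271 -/
example : NNQuasiPolyLogDegreeCofactorHard ↔
    Summit.ValiantsHypothesis.ValiantsHypothesis.Theses.FifoMatching.NNQuasiPolyLogDegreeCofactorHard := Iff.rfl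

/-- ★ item stmt-ValiantsHypothesis-27271 BY NAME, outright (the ledger closing is the Theorems port's `--workitem` filing). -/
theorem rung_27271 : Summit.ValiantsHypothesis.ValiantsHypothesis.Theses.FifoMatching.NNQuasiPolyLogDegreeCofactorHard :=
  rung_holds

/-- 27045 ⇒ 27271, both BY NAME. -/
theorem route_27271_of_27045 (hF : Summit.ValiantsHypothesis.ValiantsHypothesis.Theses.FifoMatching.GridCorCliqueFace) :
    Summit.ValiantsHypothesis.ValiantsHypothesis.Theses.FifoMatching.NNQuasiPolyLogDegreeCofactorHard :=
  rung_of_27045 hF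


/-! ## rev 10: the EXPONENTIAL rung (rates made explicit).  FORM A is LINEAR (`c·t ≤ h`) and the K1 chain is polynomial
(`t ≈ √n/4`), so the same located faces give `σ(NFP_n) ≥ 2^{Ω(√n)}`; with the tree's balancing theorem this yields
monotone hardness `2^{n^{1/8}}` of `NN_n · h` for EVERY nonzero cofactor of degree `≤ 2^{n^{1/8}}` (`n^{1/8}` := three nested
`Nat.sqrt`; the exponent `1/8` is bookkeeping slack, the geometric rate is `2^{Ω(√n)}` shadow vertices).  Everything
below is sorry-free and uses item 27045 only through `stub_cliqueFace`. -/

section ExpRung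

/-- `⌊n^{1/8}⌋`-ish in `ℕ`: three nested integer square roots. -/
def root8 (n : ℕ) : ℕ := Nat.sqrt (Nat.sqrt (Nat.sqrt n))

/-- **R2-exp — the EXPONENTIAL rung**: eventually in `n`, `2^{n^{1/8}} < L₊(NN_n · h)` for every `h ≠ 0` of total degree
`≤ 2^{n^{1/8}}` (`n^{1/8} = root8 n`).  Contains R2 (quasi-polynomial degree & threshold) and the `h = 1` exponential
bound, both eventually in `n`. -/
def NNExpDegreeCofactorHard : Prop :=
  ∃ n₀ : ℕ, ∀ n ≥ n₀, ∀ h : MvPolynomial (Fin (2 * n) × Fin (2 * n)) ℝ≥0, h ≠ 0 →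
    h.totalDegree ≤ 2 ^ root8 n → 2 ^ root8 n < complexity (nestFreeMatchingPoly n ℝ≥0 * h)

/-- **G-count** (G♭ ⇒ G with the bound left free): for `t ≥ t₀` there is `h ≥ c₀·t` such that every `B` with
`4B < 2^h` is exceeded by the vertex count of some planar shadow of `COR(G_t)`. -/
theorem gridCor_count (hF : GridCorCliqueFace) :
    ∃ c₀ : ℝ, 0 < c₀ ∧ ∃ t₀ : ℕ, ∀ t ≥ t₀, ∃ h : ℕ, c₀ * t ≤ h ∧
      ∀ B : ℕ, 4 * B < 2 ^ h → ∃ L : ((Fin (t * t) × Fin (t * t)) → ℝ) →ₗ[ℝ] (Fin 2 → ℝ),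
        B < shadowVerts (Set.range (corVec (gridGraph t))) L := by
  classical
  obtain ⟨c₀, hc₀, t₀, hF⟩ := hF
  refine ⟨c₀, hc₀, t₀, fun t ht => ?_⟩
  obtain ⟨h, hh, k, cv, δ, π, hvalid, hface⟩ := hF t ht
  refine ⟨h, hh, fun B hB4 => ?_⟩
  set S : Set (Fin (t * t) × Fin (t * t) → ℝ) := Set.range (corVec (gridGraph t)) with hSdef
  have hP : corPolytopeGraph (gridGraph t) = convexHull ℝ S := rfl
  have hSfin : S.Finite := Set.finite_range _
  -- the summed valid inequality `w x ≤ w₀` and its face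
  let w : (Fin (t * t) × Fin (t * t) → ℝ) →ₗ[ℝ] ℝ := sumDot cv
  let w₀ : ℝ := ∑ i, δ i
  have hvalidP : ∀ x ∈ convexHull ℝ S, w x ≤ w₀ := fun x hx => by
    rw [show w x = ∑ i, cv i ⬝ᵥ x from rfl]
    exact Finset.sum_le_sum fun i _ => hvalid i x (hP ▸ hx)
  have hvalidS : ∀ x ∈ S, w x ≤ w₀ := fun x hx => hvalidP x (subset_convexHull ℝ S hx)
  have htight : ∀ x ∈ convexHull ℝ S, ((∀ i, cv i ⬝ᵥ x = δ i) ↔ w x = w₀) := by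
    intro x hx
    rw [show w x = ∑ i, cv i ⬝ᵥ x from rfl]
    constructor
    · intro hall; exact Finset.sum_congr rfl fun i _ => hall i
    · intro hsum i
      have := (Finset.sum_eq_sum_iff_of_le (fun i _ => hvalid i x (hP ▸ hx))).1 hsum
      exact this i (Finset.mem_univ i)
  -- the face read-out `Y` and its hull `= COR(K_h)`
  set Y : Set (Fin h × Fin h → ℝ) := π '' (S ∩ {x | w x = w₀}) with hYdef
  have hconvY : convexHull ℝ Y = corPolytopeGraph (⊤ : SimpleGraph (Fin h)) := by
    rw [← hface, hP]
    have hE : convexHull ℝ S ∩ {x | ∀ i, cv i ⬝ᵥ x = δ i} = convexHull ℝ S ∩ {x | w x = w₀} := by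
      ext x; constructor
      · rintro ⟨hx, hall⟩; exact ⟨hx, (htight x hx).1 hall⟩
      · rintro ⟨hx, hw⟩; exact ⟨hx, (htight x hx).2 hw⟩
    rw [hE, convexHull_inter_face S w w₀ hvalidS, LinearMap.image_convexHull]
  -- the parabola shadow of `Y` has `2^h` vertices
  have hcount : (Set.extremePoints ℝ (convexHull ℝ (parab h '' Y))).ncard = 2 ^ h := by
    have : convexHull ℝ (parab h '' Y) =
        convexHull ℝ (parab h '' Set.range (corVec (⊤ : SimpleGraph (Fin h)))) := by
      rw [← LinearMap.image_convexHull, hconvY, corPolytopeGraph, LinearMap.image_convexHull]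
    rw [this]; exact clique_parabola_shadow h
  have hB : 4 * B < (Set.extremePoints ℝ (convexHull ℝ (parab h '' Y))).ncard := by
    rw [hcount]; exact hB4
  obtain ⟨L, hL⟩ := shadow_faceLift_count_face S hSfin w w₀ hvalidS π Y rfl (parab h) B hB
  exact ⟨L, hL⟩

/-- **T1-count**: the pull-back along c1's `corMap` keeps the bound. -/
theorem pp_count {c₀ : ℝ} {t₀ : ℕ}
    (hG : ∀ t ≥ t₀, ∃ h : ℕ, c₀ * t ≤ h ∧ ∀ B : ℕ, 4 * B < 2 ^ h →
      ∃ L : ((Fin (t * t) × Fin (t * t)) → ℝ) →ₗ[ℝ] (Fin 2 → ℝ),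
        B < shadowVerts (Set.range (corVec (gridGraph t))) L)
    (r : ℕ) (hr : 2 * t₀ + 2 ≤ r) :
    ∃ h : ℕ, c₀ * ((r / 2 : ℕ) : ℝ) ≤ h ∧ ∀ B : ℕ, 4 * B < 2 ^ h →
      ∃ Λ : (((QGV r × QGV r) × Bool × Bool) → ℝ) →ₗ[ℝ] (Fin 2 → ℝ),
        B < shadowVerts (Set.range (patternVec r)) Λ := by
  have hg : 2 * (r / 2) ≤ r := Nat.mul_div_le r 2
  have hgt : t₀ ≤ r / 2 := by omega
  obtain ⟨h, hh, hc⟩ := hG (r / 2) hgt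
  refine ⟨h, hh, fun B hB => ?_⟩
  obtain ⟨L, hL⟩ := hc B hB
  refine ⟨L ∘ₗ corMap r (r / 2) hg, ?_⟩
  have hcv : Set.range (corVec (gridGraph (r / 2))) = Set.range (corVertex (gridGraph (r / 2))) :=
    congrArg Set.range (funext (corVec_eq_corVertex (gridGraph (r / 2))))
  have himg : (L ∘ₗ corMap r (r / 2) hg) '' Set.range (patternVec r) =
      L '' Set.range (corVec (gridGraph (r / 2))) := by
    rw [hcv, LinearMap.coe_comp, Set.image_comp, ← Set.range_comp,
      show Set.range (⇑(corMap r (r / 2) hg) ∘ patternVec r) = Set.range (corVertex (gridGraph (r / 2))) from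
        range_corMap_patternVec r (r / 2) hg]
  have hverts : shadowVerts (Set.range (patternVec r)) (L ∘ₗ corMap r (r / 2) hg) =
      shadowVerts (Set.range (corVec (gridGraph (r / 2)))) L := by
    unfold shadowVerts
    rw [himg]
  rw [hverts]
  exact hL

/-- **T2-count**: the face lift along A1's located coordinate face costs a factor `4` in the bound (`r = ⌊√n⌋/2 − 1`). -/
theorem nfp_count {c₀ : ℝ} {r₀ : ℕ}
    (hP : ∀ r ≥ r₀, ∃ h : ℕ, c₀ * ((r / 2 : ℕ) : ℝ) ≤ h ∧ ∀ B : ℕ, 4 * B < 2 ^ h →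
      ∃ Λ : (((QGV r × QGV r) × Bool × Bool) → ℝ) →ₗ[ℝ] (Fin 2 → ℝ),
        B < shadowVerts (Set.range (patternVec r)) Λ)
    (n : ℕ) (hn : 4 * (max (r₀ + 1) 3) ^ 2 ≤ n) :
    ∃ h : ℕ, c₀ * ((((Nat.sqrt n / 2 - 1) / 2 : ℕ)) : ℝ) ≤ h ∧ ∀ B : ℕ, 16 * B < 2 ^ h →
      ∃ L : ((Fin (2 * n) × Fin (2 * n)) → ℝ) →ₗ[ℝ] (Fin 2 → ℝ),
        B < shadowVerts (suppPts (nestFreeMatchingPoly n ℝ≥0)) L := by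
  classical
  set M := max (r₀ + 1) 3 with hM
  have hM3 : 3 ≤ M := le_max_right _ _
  have hMr : r₀ + 1 ≤ M := le_max_left _ _
  set s := Nat.sqrt n with hs
  have hsM : 2 * M ≤ s := by
    rw [hs, Nat.le_sqrt]
    nlinarith [hn]
  set r := s / 2 - 1 with hr
  have hr2 : 2 ≤ r := by omega
  have hr1 : 1 ≤ r := by omega
  have hrr₀ : r₀ ≤ r := by omega
  have hr_s : r + 1 = s / 2 := by omega
  have hss : s * s ≤ n := Nat.sqrt_le n
  have hface : (r + 1) * (2 * r + 1) ≤ n := by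
    have h2 : 2 * (s / 2) ≤ s := Nat.mul_div_le s 2
    calc (r + 1) * (2 * r + 1) ≤ (r + 1) * (2 * (r + 1)) := Nat.mul_le_mul_left _ (by omega)
      _ = (s / 2) * (2 * (s / 2)) := by rw [hr_s]
      _ ≤ (s / 2) * s := Nat.mul_le_mul_left _ h2
      _ ≤ s * s := Nat.mul_le_mul_right _ (Nat.div_le_self s 2)
      _ ≤ n := hss
  obtain ⟨Z, f, hZf⟩ := queueGridZeroOnePoints_holds r n hr1 hface
  obtain ⟨h, hh, hc⟩ := hP r hrr₀
  refine ⟨h, hh, fun B hB => ?_⟩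
  obtain ⟨Λ, hΛ⟩ := hc (4 * B) (by rw [show 4 * (4 * B) = 16 * B by ring]; exact hB)
  have hΛ' : 4 * B < (Set.extremePoints ℝ (convexHull ℝ (Λ '' Set.range (patternVec r)))).ncard := hΛ
  have hSfin : (suppPts (nestFreeMatchingPoly n ℝ≥0)).Finite := (Finset.finite_toSet _).image _
  obtain ⟨hψS, hset⟩ := sumCoord_face (suppPts (nestFreeMatchingPoly n ℝ≥0)) (suppPts_coord_dichotomy _) Z
  have hY : (LinearMap.funLeft ℝ ℝ f) ''
      (suppPts (nestFreeMatchingPoly n ℝ≥0) ∩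
        {x | (∑ a ∈ Z, LinearMap.proj a : ((Fin (2 * n) × Fin (2 * n)) → ℝ) →ₗ[ℝ] ℝ) x = 0}) =
      Set.range (patternVec r) := by
    rw [hset]; exact hZf
  exact shadow_faceLift_count (suppPts (nestFreeMatchingPoly n ℝ≥0)) hSfin _ hψS (LinearMap.funLeft ℝ ℝ f)
    (Set.range (patternVec r)) hY Λ B hΛ'

/-- `16 j + 19 ≤ 2^(j+1)` for `j ≥ 8`. -/
theorem sixteen_mul_le_two_pow (j : ℕ) (hj : 8 ≤ j) : 16 * j + 19 ≤ 2 ^ (j + 1) := by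
  induction j, hj using Nat.le_induction with
  | base => norm_num
  | succ k hk ih =>
    have h16 : 16 ≤ 2 ^ (k + 1) := by
      calc (16 : ℕ) = 2 ^ 4 := by norm_num
        _ ≤ 2 ^ (k + 1) := Nat.pow_le_pow_right (by norm_num) (by omega)
    calc 16 * (k + 1) + 19 = (16 * k + 19) + 16 := by ring
      _ ≤ 2 ^ (k + 1) + 2 ^ (k + 1) := Nat.add_le_add ih h16
      _ = 2 ^ (k + 1 + 1) := by ring

/-- `2 log₂ n + 5 ≤ 2 · n^{1/8}` for `n ≥ 2^64`. -/
theorem two_log_le_root8 (n : ℕ) (hn : 2 ^ 64 ≤ n) : 2 * Nat.log 2 n + 5 ≤ 2 * root8 n := by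
  have hn0 : n ≠ 0 := by positivity
  set ℓ := Nat.log 2 n with hℓ
  have h64 : 64 ≤ ℓ := (Nat.le_log_iff_pow_le one_lt_two hn0).mpr hn
  set j := ℓ / 8 with hj
  have hj8 : 8 ≤ j := by omega
  have h8j : 8 * j ≤ ℓ := by omega
  have hℓj : ℓ ≤ 8 * j + 7 := by omega
  have hnℓ : 2 ^ ℓ ≤ n := Nat.pow_log_le_self 2 hn0
  have h1 : 2 ^ (4 * j) ≤ Nat.sqrt n := by
    rw [Nat.le_sqrt]
    calc 2 ^ (4 * j) * 2 ^ (4 * j) = 2 ^ (8 * j) := by rw [← pow_add]; ring_nf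
      _ ≤ 2 ^ ℓ := Nat.pow_le_pow_right (by norm_num) h8j
      _ ≤ n := hnℓ
  have h2 : 2 ^ (2 * j) ≤ Nat.sqrt (Nat.sqrt n) := by
    rw [Nat.le_sqrt]
    calc 2 ^ (2 * j) * 2 ^ (2 * j) = 2 ^ (4 * j) := by rw [← pow_add]; ring_nf
      _ ≤ Nat.sqrt n := h1
  have h3 : 2 ^ j ≤ root8 n := by
    unfold root8
    rw [Nat.le_sqrt]
    calc 2 ^ j * 2 ^ j = 2 ^ (2 * j) := by rw [← pow_add]; ring_nf
      _ ≤ Nat.sqrt (Nat.sqrt n) := h2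
  have h4 := sixteen_mul_le_two_pow j hj8
  calc 2 * ℓ + 5 ≤ 16 * j + 19 := by omega
    _ ≤ 2 ^ (j + 1) := h4
    _ = 2 * 2 ^ j := by ring
    _ ≤ 2 * root8 n := Nat.mul_le_mul_left 2 h3

/-- the one real-arithmetic step: with `h ≥ c₀ · ⌊(⌊√n⌋/2 − 1)/2⌋`, `c₀ ∈ (0,1]`, eventually
`18 (n^{1/8} + 2 log₂ n + 5)² + 8 < h`. -/
theorem exp_threshold {c₀ : ℝ} (hc₀ : 0 < c₀) (hc₁ : c₀ ≤ 1) :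
    ∃ n₁ : ℕ, ∀ n ≥ n₁, ∀ h : ℕ, c₀ * ((((Nat.sqrt n / 2 - 1) / 2 : ℕ)) : ℝ) ≤ h →
      18 * (root8 n + 2 * Nat.log 2 n + 5) ^ 2 + 8 < h := by
  set N : ℕ := Nat.ceil (800 / c₀) with hN
  refine ⟨max (2 ^ 64) ((N * N) * (N * N)), fun n hn h hh => ?_⟩
  have h64 : 2 ^ 64 ≤ n := le_of_max_le_left hn
  have hNN : (N * N) * (N * N) ≤ n := le_of_max_le_right hn
  set s₁ := Nat.sqrt n with hs₁
  set s₂ := Nat.sqrt s₁ with hs₂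
  have hs₃ : root8 n = Nat.sqrt s₂ := rfl
  -- `s₂ ≥ N`
  have hs₁N : N * N ≤ s₁ := by rw [hs₁, Nat.le_sqrt]; exact hNN
  have hs₂N : N ≤ s₂ := by rw [hs₂, Nat.le_sqrt]; exact hs₁N
  -- Nat facts
  have hlog := two_log_le_root8 n h64
  have hE : root8 n + 2 * Nat.log 2 n + 5 ≤ 3 * root8 n := by omega
  have h33 : root8 n * root8 n ≤ s₂ := by rw [hs₃]; exact Nat.sqrt_le s₂
  have h22 : s₂ * s₂ ≤ s₁ := by rw [hs₂]; exact Nat.sqrt_le s₁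
  have ht : s₁ ≤ 4 * ((s₁ / 2 - 1) / 2) + 7 := by omega
  have hEsq : 18 * (root8 n + 2 * Nat.log 2 n + 5) ^ 2 + 8 ≤ 162 * s₂ + 8 := by
    have := Nat.pow_le_pow_left hE 2
    nlinarith [this, h33]
  -- reals
  have hNr : 800 / c₀ ≤ (N : ℝ) := Nat.le_ceil _
  have hs₂r : (N : ℝ) ≤ s₂ := by exact_mod_cast hs₂N
  have hcs : 800 ≤ c₀ * (s₂ : ℝ) := by
    have : c₀ * (800 / c₀) = 800 := by field_simp
    nlinarith [hNr, hs₂r, hc₀.le]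
  have htr : ((s₁ : ℝ) - 7) / 4 ≤ (((s₁ / 2 - 1) / 2 : ℕ) : ℝ) := by
    have : (s₁ : ℝ) ≤ 4 * ((((s₁ / 2 - 1) / 2 : ℕ)) : ℝ) + 7 := by exact_mod_cast ht
    linarith
  have h22r : ((s₂ : ℝ)) * s₂ ≤ s₁ := by exact_mod_cast h22
  have hs₂1 : (1 : ℝ) ≤ s₂ := by
    have : (1 : ℕ) ≤ N := by
      have h8 : (0 : ℝ) < 800 / c₀ := by positivity
      have : (0 : ℝ) < N := lt_of_lt_of_le h8 hNr
      exact_mod_cast this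
    exact_mod_cast this.trans hs₂N
  have hmain : (162 * s₂ + 8 : ℝ) < h := by
    have h1 : c₀ * (((s₁ : ℝ) - 7) / 4) ≤ h := le_trans (mul_le_mul_of_nonneg_left htr hc₀.le) hh
    have h2 : c₀ * (((s₂ : ℝ) * s₂ - 7) / 4) ≤ c₀ * (((s₁ : ℝ) - 7) / 4) :=
      mul_le_mul_of_nonneg_left (by linarith) hc₀.le
    have h3 : (200 : ℝ) * s₂ - 7 / 4 ≤ c₀ * (((s₂ : ℝ) * s₂ - 7) / 4) := by nlinarith [hcs, hc₁, hc₀.le, hs₂1]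
    linarith
  have hmainN : 162 * s₂ + 8 < h := by exact_mod_cast hmain
  exact lt_of_le_of_lt hEsq hmainN

/-- **S-exp**: the NFP count with a linear-in-`√n` exponent gives the exponential rung (HY21 Thm 42 via
`nn_ncard_extremePoints_le_of_multiple` + the tree's balancing `formulaComplexity_le_two_pow`, as in `rung_of_shadow`). -/
theorem expRung_of_count {c₀ : ℝ} (hc₀ : 0 < c₀) (hc₁ : c₀ ≤ 1) {n₀ : ℕ}
    (hN : ∀ n ≥ n₀, ∃ h : ℕ, c₀ * ((((Nat.sqrt n / 2 - 1) / 2 : ℕ)) : ℝ) ≤ h ∧ ∀ B : ℕ, 16 * B < 2 ^ h →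
      ∃ L : ((Fin (2 * n) × Fin (2 * n)) → ℝ) →ₗ[ℝ] (Fin 2 → ℝ),
        B < shadowVerts (suppPts (nestFreeMatchingPoly n ℝ≥0)) L) :
    NNExpDegreeCofactorHard := by
  obtain ⟨n₁, hn₁⟩ := exp_threshold hc₀ hc₁
  refine ⟨max n₀ n₁, fun n hn h hh hdeg => ?_⟩
  have hn0 : n₀ ≤ n := le_of_max_le_left hn
  have hn1 : n₁ ≤ n := le_of_max_le_right hn
  by_contra hs
  push Not at hs
  obtain ⟨H, hH, hcount⟩ := hN n hn0
  set ℓ := Nat.log 2 n with hℓ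
  set m := root8 n with hm
  set E := m + 2 * ℓ + 5 with hE
  have h2E : 2 ^ E = 2 ^ m * 2 ^ (ℓ + 1) * 2 ^ (ℓ + 1) * 8 := by
    rw [hE, show m + 2 * ℓ + 5 = m + (ℓ + 1) + (ℓ + 1) + 3 by omega, pow_add, pow_add, pow_add]
    norm_num
  have hnlt : n < 2 ^ (ℓ + 1) := Nat.lt_pow_succ_log_self Nat.one_lt_two n
  have ha1 : 1 ≤ 2 ^ m := Nat.one_le_two_pow
  have hb1 : 1 ≤ 2 ^ (ℓ + 1) := Nat.one_le_two_pow
  have hprod : 2 ^ (ℓ + 1) * 2 ^ (ℓ + 1) ≤ 2 ^ m * 2 ^ (ℓ + 1) * 2 ^ (ℓ + 1) := by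
    calc 2 ^ (ℓ + 1) * 2 ^ (ℓ + 1) = 1 * 2 ^ (ℓ + 1) * 2 ^ (ℓ + 1) := by ring
      _ ≤ 2 ^ m * 2 ^ (ℓ + 1) * 2 ^ (ℓ + 1) := Nat.mul_le_mul_right _ (Nat.mul_le_mul_right _ ha1)
  have hsq : 2 ^ (ℓ + 1) ≤ 2 ^ (ℓ + 1) * 2 ^ (ℓ + 1) := Nat.le_mul_of_pos_right _ (by omega)
  have hBle : 2 ^ m ≤ 2 ^ m * 2 ^ (ℓ + 1) * 2 ^ (ℓ + 1) := by
    calc 2 ^ m = 2 ^ m * 1 * 1 := by ring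
      _ ≤ 2 ^ m * 2 ^ (ℓ + 1) * 2 ^ (ℓ + 1) := Nat.mul_le_mul (Nat.mul_le_mul_left _ hb1) hb1
  have hd : n + 2 ^ m < 2 ^ E := by rw [h2E]; omega
  have hcard : Fintype.card (Fin (2 * n) × Fin (2 * n)) ≤ 2 ^ E := by
    rw [Fintype.card_prod, Fintype.card_fin, h2E]
    calc 2 * n * (2 * n) = 4 * (n * n) := by ring
      _ ≤ 4 * (2 ^ (ℓ + 1) * 2 ^ (ℓ + 1)) := Nat.mul_le_mul_left 4 (Nat.mul_le_mul hnlt.le hnlt.le)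
      _ ≤ 4 * (2 ^ m * 2 ^ (ℓ + 1) * 2 ^ (ℓ + 1)) := Nat.mul_le_mul_left 4 hprod
      _ ≤ 2 ^ m * 2 ^ (ℓ + 1) * 2 ^ (ℓ + 1) * 8 := by omega
  have hNN : (nestFreeMatchingPoly n ℝ≥0).totalDegree ≤ n := by
    simpa using (nestFreeMatchingPoly_isHomogeneous (n := n) (k := ℝ≥0)).totalDegree_le
  have hdeg' : (nestFreeMatchingPoly n ℝ≥0 * h).totalDegree ≤ n + 2 ^ m :=
    calc (nestFreeMatchingPoly n ℝ≥0 * h).totalDegree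
        ≤ (nestFreeMatchingPoly n ℝ≥0).totalDegree + h.totalDegree := totalDegree_mul _ _
      _ ≤ n + 2 ^ m := add_le_add hNN hdeg
  have hL' : complexity (nestFreeMatchingPoly n ℝ≥0 * h) ≤ 2 ^ E :=
    hs.trans (Nat.pow_le_pow_right Nat.two_pos (by omega : m ≤ E))
  have hE1 : 1 ≤ E := by omega
  have hfc := formulaComplexity_le_two_pow hdeg' hd hcard hL' hE1
  have harith : 18 * E ^ 2 + 8 < H := hn₁ n hn1 H hH
  obtain ⟨L, hL⟩ := hcount (2 ^ (18 * E ^ 2 + 4)) (by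
    calc 16 * 2 ^ (18 * E ^ 2 + 4) = 2 ^ (18 * E ^ 2 + 8) := by
          have h8 : 18 * E ^ 2 + 8 = (18 * E ^ 2 + 4) + 4 := by omega
          rw [h8, pow_add _ (18 * E ^ 2 + 4) 4]
          have h16 : (2 : ℕ) ^ 4 = 16 := by norm_num
          rw [h16]; omega
      _ < 2 ^ H := Nat.pow_lt_pow_right (by norm_num) harith)
  have hV := nn_ncard_extremePoints_le_of_multiple L h hh
  have hfinal : (Set.extremePoints ℝ (convexHull ℝ (L '' suppPts (nestFreeMatchingPoly n ℝ≥0)))).ncard ≤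
      2 ^ (18 * E ^ 2 + 4) :=
    calc (Set.extremePoints ℝ (convexHull ℝ (L '' suppPts (nestFreeMatchingPoly n ℝ≥0)))).ncard
        ≤ 4 * (3 * formulaComplexity (nestFreeMatchingPoly n ℝ≥0 * h) + 1) := hV
      _ ≤ 4 * (3 * 2 ^ (18 * E ^ 2) + 1) :=
          Nat.mul_le_mul_left 4 (Nat.add_le_add_right (Nat.mul_le_mul_left 3 hfc) 1)
      _ ≤ 2 ^ (18 * E ^ 2 + 4) := by
          rw [pow_add]
          have h16 : (2 : ℕ) ^ 4 = 16 := by norm_num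
          rw [h16]
          have := Nat.one_le_two_pow (n := 18 * E ^ 2)
          omega
  exact absurd hL (not_lt.2 hfinal)

/-- ★ **R2-exp HOLDS**: eventually, `2^{n^{1/8}} < L₊(NN_n · h)` for every nonzero cofactor of degree `≤ 2^{n^{1/8}}` —
from item 27045 (G♭, a theorem), A1 (a theorem), HY21 Prop 19 / Lemma 10 / Thm 42 and balancing, all in the tree. -/
theorem expRung_holds : NNExpDegreeCofactorHard := by
  obtain ⟨c₀, hc₀, t₀, hG⟩ := gridCor_count stub_cliqueFace
  have hc₁ : 0 < min c₀ 1 := lt_min hc₀ one_pos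
  have hc₁1 : min c₀ 1 ≤ 1 := min_le_right _ _
  have hG' : ∀ t ≥ t₀, ∃ h : ℕ, min c₀ 1 * t ≤ h ∧ ∀ B : ℕ, 4 * B < 2 ^ h →
      ∃ L : ((Fin (t * t) × Fin (t * t)) → ℝ) →ₗ[ℝ] (Fin 2 → ℝ),
        B < shadowVerts (Set.range (corVec (gridGraph t))) L := by
    intro t ht
    obtain ⟨h, hh, hc⟩ := hG t ht
    exact ⟨h, (mul_le_mul_of_nonneg_right (min_le_left _ _) (Nat.cast_nonneg t)).trans hh, hc⟩
  have hP : ∀ r ≥ 2 * t₀ + 2, _ := fun r hr => pp_count hG' r hr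
  have hN : ∀ n ≥ 4 * (max (2 * t₀ + 2 + 1) 3) ^ 2, _ := fun n hn => nfp_count hP n hn
  exact expRung_of_count hc₁ hc₁1 hN

/-- the `h = 1` instance: an explicit-exponent form of the eventual exponential bound for `NN_n` itself -/
theorem expBound_of_expRung (hX : NNExpDegreeCofactorHard) :
    ∃ n₀ : ℕ, ∀ n ≥ n₀, 2 ^ root8 n < complexity (nestFreeMatchingPoly n ℝ≥0) := by
  obtain ⟨n₀, hX⟩ := hX
  refine ⟨n₀, fun n hn => ?_⟩
  simpa using hX n hn 1 one_ne_zero (by simp)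

/-- ★ eventually `2^{n^{1/8}} < L₊(NN_n)` (explicit exponent; the route item 22994 `NNMonotoneExpBound` is the `∃ ε` form,
closed independently by the thick-queue argument). -/
theorem expBound_holds : ∃ n₀ : ℕ, ∀ n ≥ n₀, 2 ^ root8 n < complexity (nestFreeMatchingPoly n ℝ≥0) :=
  expBound_of_expRung expRung_holds

end ExpRung

#print axioms expRung_holds

end Summit.ValiantsHypothesis.ValiantsHypothesis.Cruxes.NNLinearDegreeCofactorHard.ShadowDivision
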